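import Mathlib

/-!
# Dimock, *The renormalization group according to Balaban* II, App. E "disconnected polymer sums": LEMMA E.2
(kumquat) — `Σ_{Y ∋ □₀} exp(−a′ℓ′(Y)) ≤ b′` over ARBITRARY (not necessarily connected) finite collections of blocks,
`ℓ′` = the minimal tree length on the block centres — PROVED, with explicit constants, by the tree-graph bound
organised by generations; part (2) from part (1) by the printed arithmetic; (v1.1) LEMMA E.1 (1)–(2) in graph form —
pruning, the centre replacement `ℓ′ ≤ ℓ + (|Y|−1)`, and the Steiner ratio `ℓ ≤ 2ℓ̃` ([DIS73]) by generations

**Citation header (reproduction of PUBLISHED work; template of the Balaban lattice Yang–Mills cell).**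
J. Dimock, *The renormalization group according to Balaban. II. Large fields*, J. Math. Phys. **54** (2013) 092301
(= arXiv:1212.5562v2) [Dimock2013BalabanII]: Appendix E `\section{disconnected polymer sums} \label{tree}` (TeX
L6776–6966; lemma numbering `\newtheorem{lem}{Lemma}[section]`): the definitions L6779–6788, Lemma E.1 `\label{steamy}`
(L6790–6798, proof L6802–6828), Lemma E.2 `\label{kumquat}` (L6833–6845, proof L6854–6909), the remark L6849–6850.
TeX line numbers refer to the arXiv source held by the cell (`inputs/files/dimock/src/1212.5562/1212.5562.tex`,
sha256[:16] 75c5792fc48eacbc).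

**What the paper prints (verbatim).**  L6779–6788: *"Let Y be a collection of M-blocks □ in a lattice of dimension
d. Y is not necessarily connected. We define various lengths ℓ(Y), ℓ′(Y), ℓ̃(Y) associated with Y. In the following
''tree'' means continuum tree. 1. M ℓ′_M(Y) is the length of a minimal tree whose vertices are the centers of the
blocks in Y. 2. M ℓ_M(Y) is the length of a minimal tree whose vertices are one point from each block in Y. 3. M ℓ̃_M(Y)
is the length of a minimal tree whose vertices are one point from each block in Y and possibly other points. We have
trivially ℓ̃_M(Y) ≤ ℓ_M(Y) ≤ ℓ′_M(Y). … Recall also that |Y|_M is the number of M-blocks in Y."*  L6811 (proof of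
E.1 (2)): *"(We use the metric |x−y| = sup_μ|x_μ − y_μ|)."*  **Lemma E.1** (L6790–6798): *"1. ℓ_M(Y) ≤ 2ℓ̃_M(Y)  2.
ℓ′_M(Y) ≤ ℓ_M(Y) + |Y|_M  3. |Y|_M ≤ 4(2^d+1)(ℓ_M(Y)+1)"*.  **Lemma E.2** (L6833–6845): *"1. There are constants
a′, b′ = 𝒪(1) such that for any M-cube □₀  Σ_{Y : Y ⊃ □₀} exp(−a′ℓ′_M(Y)) ≤ b′  2. There are constants a, b = 𝒪(1)
such that  Σ_{Y : Y ⊃ □₀} exp(−aℓ_M(Y)) ≤ b"*; Remark (L6849–6850): *"These generalize bounds in part I where Y was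
required to be connected. Bounds of this type were used extensively in the papers of Gawedski and Kupiainen, see for
example [GaKu81]."*  PROOF of (1) (L6856–6893): *"We take M=1 and drop the subscript M. The sum is dominated by
Σ_{n=0}^∞ Σ_{{□_1,…,□_n}} exp(−a′ℓ′(□₀ ∪ □_1 ∪ ⋯ ∪ □_n)) = Σ_{n=0}^∞ (1/n!) Σ_{(□_1,…,□_n)} exp(−a′ℓ′(□₀ ∪ □_1 ∪ ⋯ ∪
□_n)) … For every (□_1,…,□_n) there is at least one tree τ on (0,1,2,…,n) such that the induced length d_τ(□₀,□_1,
…,□_n) ≡ Σ_{{i,j}∈τ} d′(□_i,□_j) satisfies d_τ(□₀,□_1,…,□_n) = ℓ′(□₀,□_1,…,□_n). Here d′(□,□′) is the distance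
between centers. … Now we sum over the outer leaves of the tree working our way back to the root at 0, using the
bound Σ_{□′: □′ ≠ □} exp(−a′d′(□,□′)) ≤ 𝒪(1)e^{−a′}  Then the expression is dominated by Σ_{n=0}^∞ (1/n!)(𝒪(1)
e^{−a′})^n Σ_τ 1 ≤ Σ_{n=0}^∞ (𝒪(1)e^{−a′})^n ≤ 𝒪(1) for a′ sufficiently large. Here we use Cayley's formula that
there are n^{n−2} tree graphs on n vertices. Here this is (n+1)^{n−1} ≤ 𝒪(1)^n n!."*  PROOF of (2) (L6896–6908):
*"Using the second and third bound in lemma* [E.1] *we have for a,b sufficiently large  Σ_{Y : Y ⊃ □₀} exp(−aℓ(Y)) ≤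
Σ_{Y : Y ⊃ □₀} exp(−(a−a′)ℓ(Y) + a′|Y| − a′ℓ′(Y)) ≤ 𝒪(1)Σ_{Y : Y ⊃ □₀} exp(−(a−𝒪(1))ℓ(Y)) exp(−a′ℓ′(Y)) ≤ 𝒪(1)
Σ_{Y : Y ⊃ □₀} exp(−a′ℓ′(Y)) ≤ b"*.

**What is reproduced here (kernel-checked, zero `sorry`).**
* Part 1 — the object `ℓ′`: for ANY vertex type `P` and ANY weight `φ : Sym2 P → ℝ` on pairs ("the distance between
  centers"), `treeLen' φ Y` = the minimum, over the edge sets `E ⊆ Y.sym2` without loops that CONNECT the finite set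
  `Y`, of `Σ_{e∈E} φ e` — the length of a minimal connecting graph with vertex set exactly `Y`.  Every tree graph on
  the centres is such an edge set, so `treeLen' ≤` the printed minimum over trees and the bounds below IMPLY the printed
  ones verbatim (for `φ ≥ 0` the two minima coincide — a minimal connecting set can be pruned to a tree — which is
  neither needed nor proved); `treeLen'_le_wt`, `exists_conn_wt_eq`, `treeLen'_singleton`, `treeLen'_nonneg`.
* Part 2 — the GENERATION STEP of the tree sum (the device *"sum over the outer leaves of the tree working our way
  back to the root"*, organised from the root): for `p ∈ Y` and a minimal connecting `E`, removing `p` splits `E`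
  into the edges at `p` and the connected components `K` of the rest, each `K` containing a vertex `r_K` joined to
  `p` (`exists_root`, a last-exit induction along the connecting chain); `Y ∖ {p} = ⊔_K K` and
  **`treeLen'_ge_sum_branches`**: `ℓ′(Y) ≥ Σ_K (φ s(p, r_K) + ℓ′(K))`.
* Part 3 — **`sum_exp_neg_treeLen'_le`** = Lemma E.2 (1) in ABSTRACT form, PROVED by induction on `#Y` (generations):
  if `Σ_{q∈S} exp(−φ s(p,q)) ≤ w` for every vertex `p` and finite `S ∌ p` (the printed one-vertex bound *"Σ_{□′ ≠ □}
  exp(−a′d′(□,□′)) ≤ 𝒪(1)e^{−a′}"*) and `exp(w·b) ≤ b`, then for every `p` and every finite family `𝒴` of finite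
  sets containing `p`: `Σ_{Y∈𝒴} exp(−ℓ′(Y)) ≤ b`.  The step: `Y ↦ {(r_K, K)}_K` is injective, so `Σ_Y Π_K a(r_K,K) ≤
  Σ_{𝒞 ⊆ 𝒫} Π_{𝒞} a = Π_{𝒫}(1 + a) ≤ exp(Σ_𝒫 a)` (`Finset.prod_one_add`; sums over SETS of distinct branches need no
  `1/n!`), and `Σ_𝒫 a = Σ_r e^{−φ(p,r)} Σ_{K ∋ r} e^{−ℓ′(K)} ≤ w·b` by the induction hypothesis at the base point `r`.
* Part 3b — the lattice shadow of Lemma E.1 (3), abstractly: a connecting edge set on `Y` has at least `#Y − 1`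
  edges (`card_sub_one_le_card_of_isConnOn`, by generations with unit weights), so `ℓ′(Y) ≥ m(#Y − 1)` whenever
  `φ ≥ m ≥ 0` off the diagonal (`mul_card_sub_one_le_treeLen'`).
* Part 4 — Lemma E.2 (2) FROM (1) by the printed arithmetic, MODEL-FREE: for abstract `ℓ, ℓ′, |·|` with the shapes
  of Lemma E.1 (2) `ℓ′ ≤ ℓ + |Y|` and (3) `|Y| ≤ c(ℓ + 1)` as hypotheses, `exp(−aℓ(Y)) ≤ e^{ca/(1+c)}
  exp(−(a/(1+c))ℓ′(Y))` (`exp_neg_ell_le`) and hence `Σ exp(−aℓ) ≤ e^{ca/(1+c)}·b′` from any bound `Σ exp(−(a/(1+c))ℓ′)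
  ≤ b′` (`kumquat_two_of_one`) — *"a, b sufficiently large"* explicit.
* Part 5 — THE PRINTED INSTANCE: blocks = points of `ℤ^d` (their centres), `d′` = the sup metric (L6811) =
  `supDist` (ℕ-valued), `φ = a′·d′`; the one-vertex bound with its constant EXPLICIT: `#{x : d′(x,p) ≤ s} = (2s+1)^d`
  (`card_box`), `Σ_{q∈S, q≠p} e^{−a′d′(p,q)} ≤ 1/7` once `3^d e^{−a′} ≤ 1/8` (`one_vertex_sum_le`); hence
  **`kumquat_one`**: whenever `3^d e^{−a′} ≤ 1/8` (e.g. `a′ ≥ log 8 + d log 3`, `three_pow_mul_exp_neg_le`), for every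
  centre `x₀` and every finite family `𝒴` of finite `Y ⊂ ℤ^d` with `x₀ ∈ Y`, `Σ_{Y∈𝒴} exp(−a′ℓ′(Y)) ≤ 2` (`b′ = 2`
  since `exp(2/7) ≤ 2`); the lattice shadow of E.1: `a′(#Y − 1) ≤ ℓ′_{a′}(Y)` (`card_sub_one_le_treeLen'`, every edge
  between distinct centres has `d′ ≥ 1`), whence the volume-weighted form **`kumquat_one_volume`**: `Σ_{Y∈𝒴}
  exp(−aℓ′(Y) + c(#Y − 1)) ≤ 2` for `c ≥ 0` and `3^d e^{−(a−c)} ≤ 1/8` (the shape *"exp(−½κ₀ℓ_M(Y) + 𝒪(1)|Y|_M)"* of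
  the proof of Lemma E.3, L6946–6953).
* Part 6 (v1.1) — LEMMA E.1 (1)–(2) IN GRAPH FORM: **`exists_conn_subset_card_le`** (pruning by generations: every
  connecting edge set of `Y ≠ ∅` contains a connecting subset with `≤ #Y − 1` edges), **`treeLen'_le_treeLen'_add`**
  = E.1 (2) abstractly (`φ₂ ≤ φ₁ + c` off the diagonal ⇒ `ℓ′_{φ₂}(Y) ≤ ℓ′_{φ₁}(Y) + c(#Y − 1)`; in print `φ₁` = the
  distance of the chosen points, `φ₂` = of the centres, `c = 1`: *"This increases the lengths by at most one"*),
  **`treeLen'_le_two_mul_wt`** = E.1 (1) `ℓ ≤ 2ℓ̃` ([DIS73]) for FINITE GRAPHS over any pseudo-metric `d`: if `E`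
  connects `V ⊇ R ≠ ∅` (Steiner points `V ∖ R`) then `ℓ′_d(R) ≤ 2·Σ_{e∈E} d(e)` — by generations
  (`steiner_potential`: `∃ t ∈ R, ℓ′_d(R) + 2d(x,t) ≤ 2·wt_d(E)`, the factor `2` absorbing the detours through the
  roots) instead of the print's Euler tour; combined form **`treeLen'_le_two_mul_steiner_add`**: `ℓ′(Y) ≤ 2·wt(E) +
  c(#Y − 1)` for any Steiner witness `E` on blocks weighted by the distance of one chosen point per block.

**DEVIATION (declared).**  The print bounds the number of labelled trees by Cayley's formula (*"(n+1)^{n−1} ≤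
𝒪(1)^n n!"*) after passing to ordered collections with `1/n!`; Mathlib has no Cayley formula, and the SAME tree sum is
organised here recursively from the root (Part 2–3): the branches at the root are summed as a SET of vertex-disjoint
pointed sub-collections, `Σ_{𝒞⊆𝒫} Π a = Π(1+a) ≤ e^{Σa}` replacing `Σ_τ 1/n!`, and the induction hypothesis replacing
the leaf-by-leaf summation — the inductive form of the tree-graph bound that the remark L6849–6850 attributes to
[GaKu81].  Constants: `a′ ≥ log(8·3^d)`, `b′ = 2` (print: `𝒪(1)`).  The abstract Part 3 needs NO metric axioms on
`d′` (only the uniform one-vertex sum), so it applies verbatim to `M`-blocks, to the torus, or to multiscale cubes.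

**What is NOT claimed.**  Lemma E.1 (1)–(2) are proved in GRAPH form only (Part 6, v1.1: Steiner witnesses are
finite connecting edge sets on a superset of the chosen points, not continuum trees); the CONTINUUM statement for the
lengths `ℓ`, `ℓ̃` of L6779–6788 (polygonal trees, subdivided at the blocks they meet — the cell's
`Balaban1983to89.TreeLength.steinerLen`) is NOT formalised, and E.1 (3) only as its lattice shadow `#Y − 1 ≤ ℓ′(Y)`;
Part 4 takes the shapes (2),(3) as hypotheses.  Lemma E.3 (summit) = (snow) is NOT touched here: it is kernel since cell TEMPLATE
v8.17 by another route (`Dimock2011to13/HoleSummability.sum_exp_torusTreeLenMod_le`, relative Steiner animals), not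
via E.1/E.2.  Nothing of Bałaban's papers is asserted; on the Bałaban side sums of this type are the (1.26)/(2.45)-type
bounds *"see [48,50,40,26,3]"* (cell TEMPLATE §15.1 G5), for CONNECTED domains, already kernel on the cell's carriers.
Dimock's papers are the cell's TEMPLATE, published and refereed.  Value = the last un-formalised combinatorial lemma
of App. E on the template side (TEMPLATE §15.1 G5 / §15.2: *"Lemmas E.1 (1)–(2), E.2 (kumquat) NOT reproduced"*),
with explicit constants; NOT summit progress.

Cell records: TEMPLATE.md §15.1 rows G1/G5, §15.2; GAPS C-tmpl27-1 (v1), C-tmpl27-2 (v1.1 Part 6); unit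
`b2b-balaban-template` gen 27 (v1 p193875; v1.1 = + Part 6, v1 declarations byte-identical).  NEW leaf; imports Mathlib
only; modifies nothing.
-/

noncomputable section

open Finset Real
open scoped Classical

namespace Literature.MathematicalPhysics.QuantumFieldTheory.Dimock2011to13.DisconnectedPolymerSums

/-! ## Part 1. The minimal tree length `ℓ′` on an arbitrary weighted vertex set -/

variable {P : Type*}

/-- The adjacency of an edge set `E`: `u ~ v` iff `s(u,v) ∈ E`. [folklore] -/
def EAdj (E : Finset (Sym2 P)) (u v : P) : Prop := s(u, v) ∈ E

/-- The edge adjacency is symmetric (`s(u,v) = s(v,u)`). [folklore] -/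
theorem eAdj_symm {E : Finset (Sym2 P)} {u v : P} (h : EAdj E u v) : EAdj E v u := by
  unfold EAdj at *; rwa [Sym2.eq_swap]

/-- Reachability along `E` is symmetric. [folklore] -/
theorem reflTransGen_eAdj_symm {E : Finset (Sym2 P)} {u v : P} (h : Relation.ReflTransGen (EAdj E) u v) :
    Relation.ReflTransGen (EAdj E) v u := by
  induction h with
  | refl => exact Relation.ReflTransGen.refl
  | tail _ hbc ih => exact Relation.ReflTransGen.head (eAdj_symm hbc) ih

/-- `E` is a loop-free edge set on the vertex set `Y` which CONNECTS `Y` ("a tree graph whose vertices are the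
centers of the blocks in Y", minimality aside). [cite: Dimock2013BalabanII, App. E (arXiv:1212.5562v2 TeX L6779–6782)] -/
def IsConnOn (Y : Finset P) (E : Finset (Sym2 P)) : Prop :=
  E ⊆ Y.sym2 ∧ (∀ e ∈ E, ¬e.IsDiag) ∧ ∀ x ∈ Y, ∀ y ∈ Y, Relation.ReflTransGen (EAdj E) x y

/-- The connecting edge sets of `Y` (a finite family: subsets of `Y.sym2`). [folklore] -/
def connSets (Y : Finset P) : Finset (Finset (Sym2 P)) := Y.sym2.powerset.filter (IsConnOn Y)

/-- Membership in `connSets`. [folklore] -/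
theorem mem_connSets {Y : Finset P} {E : Finset (Sym2 P)} : E ∈ connSets Y ↔ IsConnOn Y E := by
  unfold connSets; simp only [mem_filter, mem_powerset, and_iff_right_iff_imp]; exact fun h => h.1

/-- The complete loop-free graph on `Y`. [folklore] -/
def complete (Y : Finset P) : Finset (Sym2 P) := Y.sym2.filter fun e => ¬e.IsDiag

/-- The complete loop-free graph connects `Y` (one edge per pair of distinct vertices). [folklore] -/
theorem complete_isConnOn (Y : Finset P) : IsConnOn Y (complete Y) := by
  refine ⟨filter_subset _ _, fun e he => (mem_filter.1 he).2, fun x hx y hy => ?_⟩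
  by_cases hxy : x = y
  · subst hxy; exact Relation.ReflTransGen.refl
  · refine Relation.ReflTransGen.single ?_
    unfold EAdj complete
    rw [mem_filter, Finset.mk_mem_sym2_iff, Sym2.mk_isDiag_iff]
    exact ⟨⟨hx, hy⟩, hxy⟩

/-- There is always a connecting edge set (the complete graph), so the minimum defining `ℓ′` exists. [folklore] -/
theorem connSets_nonempty (Y : Finset P) : (connSets Y).Nonempty :=
  ⟨complete Y, mem_connSets.2 (complete_isConnOn Y)⟩

/-- The total weight `Σ_{e∈E} φ e` of an edge set. [folklore] -/
def wt (φ : Sym2 P → ℝ) (E : Finset (Sym2 P)) : ℝ := ∑ e ∈ E, φ e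

/-- **`ℓ′`** — [Dimock2013BalabanII] App. E, verbatim: *"M ℓ′_M(Y) is the length of a minimal tree whose vertices
are the centers of the blocks in Y"* — for an arbitrary weight `φ` on pairs of vertices ("the distance between
centers" `d′`, L6870): the minimum over the connecting loop-free edge sets `E` on `Y` of `Σ_{e∈E} φ e`.
[cite: Dimock2013BalabanII, App. E (arXiv:1212.5562v2 TeX L6779–6782)] -/
def treeLen' (φ : Sym2 P → ℝ) (Y : Finset P) : ℝ := (connSets Y).inf' (connSets_nonempty Y) (wt φ)

/-- `ℓ′(Y)` is at most the weight of any connecting edge set. [folklore] -/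
theorem treeLen'_le_wt {φ : Sym2 P → ℝ} {Y : Finset P} {E : Finset (Sym2 P)} (hE : IsConnOn Y E) :
    treeLen' φ Y ≤ wt φ E :=
  Finset.inf'_le _ (mem_connSets.2 hE)

/-- `ℓ′(Y)` is attained by some connecting edge set (a finite minimum). [folklore] -/
theorem exists_conn_wt_eq (φ : Sym2 P → ℝ) (Y : Finset P) : ∃ E, IsConnOn Y E ∧ wt φ E = treeLen' φ Y := by
  obtain ⟨E, hE, h⟩ := Finset.exists_mem_eq_inf' (connSets_nonempty Y) (wt φ)
  exact ⟨E, mem_connSets.1 hE, h.symm⟩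

/-- A lower bound valid for every connecting edge set is a lower bound for `ℓ′`. [folklore] -/
theorem le_treeLen' {φ : Sym2 P → ℝ} {Y : Finset P} {c : ℝ} (h : ∀ E, IsConnOn Y E → c ≤ wt φ E) :
    c ≤ treeLen' φ Y := by
  obtain ⟨E, hE, hw⟩ := exists_conn_wt_eq φ Y
  rw [← hw]; exact h E hE

/-- On a loop-free edge set inside `{p}.sym2` there are no edges: `ℓ′({p}) = 0`. [folklore] -/
theorem treeLen'_singleton (φ : Sym2 P → ℝ) (p : P) : treeLen' φ {p} = 0 := by
  obtain ⟨E, hE, hw⟩ := exists_conn_wt_eq φ ({p} : Finset P)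
  have hE0 : E = ∅ := by
    rw [Finset.eq_empty_iff_forall_notMem]
    intro e he
    have h1 := hE.1 he
    have h2 := hE.2.1 e he
    induction e using Sym2.ind with
    | h a b =>
      rw [Finset.mk_mem_sym2_iff, mem_singleton, mem_singleton] at h1
      rw [Sym2.mk_isDiag_iff] at h2
      exact h2 (h1.1.trans h1.2.symm)
  rw [← hw, hE0]; simp [wt]

/-- `ℓ′ ≥ 0` for weights that are non-negative off the diagonal. [folklore] -/
theorem treeLen'_nonneg {φ : Sym2 P → ℝ} (hφ : ∀ e, ¬e.IsDiag → 0 ≤ φ e) (Y : Finset P) : 0 ≤ treeLen' φ Y :=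
  le_treeLen' fun _ hE => Finset.sum_nonneg fun e he => hφ e (hE.2.1 e he)

/-- Vertices of edges of a connecting set lie in `Y`. [folklore] -/
theorem mem_of_eAdj {Y : Finset P} {E : Finset (Sym2 P)} (hE : IsConnOn Y E) {u v : P} (h : EAdj E u v) :
    u ∈ Y ∧ v ∈ Y := by
  have := hE.1 h
  rwa [Finset.mk_mem_sym2_iff] at this

/-- Edges of a loop-free set join distinct vertices. [folklore] -/
theorem ne_of_eAdj {Y : Finset P} {E : Finset (Sym2 P)} (hE : IsConnOn Y E) {u v : P} (h : EAdj E u v) :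
    u ≠ v := by
  have := hE.2.1 _ h
  rwa [Sym2.mk_isDiag_iff] at this

/-! ## Part 2. The generation step: remove the root, split into branches -/

section Branches

variable {Y : Finset P} {E : Finset (Sym2 P)} {p : P}

/-- The adjacency of `E` away from `p` (the edges not at `p`). [folklore] -/
def EAdj' (E : Finset (Sym2 P)) (p : P) (u v : P) : Prop := EAdj E u v ∧ u ≠ p ∧ v ≠ p

/-- The adjacency away from `p` is symmetric. [folklore] -/
theorem eAdj'_symm {u v : P} (h : EAdj' E p u v) : EAdj' E p v u := ⟨eAdj_symm h.1, h.2.2, h.2.1⟩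

/-- Reachability away from `p` is symmetric. [folklore] -/
theorem rtg'_symm {u v : P} (h : Relation.ReflTransGen (EAdj' E p) u v) :
    Relation.ReflTransGen (EAdj' E p) v u := by
  induction h with
  | refl => exact Relation.ReflTransGen.refl
  | tail _ hbc ih => exact Relation.ReflTransGen.head (eAdj'_symm hbc) ih

/-- The branch (connected component away from `p`) of a vertex `y`. [folklore] -/
def comp (Y : Finset P) (E : Finset (Sym2 P)) (p y : P) : Finset P :=
  (Y.erase p).filter fun z => Relation.ReflTransGen (EAdj' E p) y z

/-- Membership in a branch. [folklore] -/
theorem mem_comp {y z : P} : z ∈ comp Y E p y ↔ z ∈ Y.erase p ∧ Relation.ReflTransGen (EAdj' E p) y z := by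
  unfold comp; rw [mem_filter]

/-- A branch lies in `Y ∖ {p}`. [folklore] -/
theorem comp_subset (y : P) : comp Y E p y ⊆ Y.erase p := filter_subset _ _

/-- A vertex of `Y ∖ {p}` lies in its own branch. [folklore] -/
theorem self_mem_comp {y : P} (hy : y ∈ Y.erase p) : y ∈ comp Y E p y :=
  mem_comp.2 ⟨hy, Relation.ReflTransGen.refl⟩

/-- Mutually reachable vertices have the same branch. [folklore] -/
theorem comp_eq_of_rtg {y y' : P} (h : Relation.ReflTransGen (EAdj' E p) y y') : comp Y E p y = comp Y E p y' := by
  ext z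
  rw [mem_comp, mem_comp]
  exact ⟨fun ⟨hz, hyz⟩ => ⟨hz, (rtg'_symm h).trans hyz⟩, fun ⟨hz, hyz⟩ => ⟨hz, h.trans hyz⟩⟩

/-- The branch of any of its members is the branch itself. [folklore] -/
theorem comp_eq_of_mem {y z : P} (hz : z ∈ comp Y E p y) : comp Y E p z = comp Y E p y :=
  (comp_eq_of_rtg (mem_comp.1 hz).2).symm

/-- Distinct branches are disjoint. [folklore] -/
theorem disjoint_comp_of_ne {y y' : P} (h : comp Y E p y ≠ comp Y E p y') :
    Disjoint (comp Y E p y) (comp Y E p y') := by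
  rw [Finset.disjoint_left]
  intro z hz hz'
  exact h ((comp_eq_of_mem hz).symm.trans (comp_eq_of_mem hz'))

/-- The set of branches at `p`. [folklore] -/
def branches (Y : Finset P) (E : Finset (Sym2 P)) (p : P) : Finset (Finset P) := (Y.erase p).image (comp Y E p)

/-- The branches at `p` cover `Y ∖ {p}`. [folklore] -/
theorem biUnion_branches : (branches Y E p).biUnion id = Y.erase p := by
  ext z
  simp only [branches, mem_biUnion, mem_image, id, exists_exists_and_eq_and]
  constructor
  · rintro ⟨y, _, hz⟩; exact comp_subset y hz
  · intro hz; exact ⟨z, hz, self_mem_comp hz⟩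

/-- The branches at `p` are pairwise disjoint. [folklore] -/
theorem pairwiseDisjoint_branches : (branches Y E p : Set (Finset P)).PairwiseDisjoint id := by
  intro K hK K' hK' hne
  simp only [branches, coe_image, Set.mem_image, mem_coe] at hK hK'
  obtain ⟨y, _, rfl⟩ := hK
  obtain ⟨y', _, rfl⟩ := hK'
  exact disjoint_comp_of_ne hne

/-- LAST EXIT FROM THE ROOT: if `E` connects `Y` and `y ∈ Y`, `y ≠ p`, then some `r` adjacent to `p` reaches `y`
away from `p`. [folklore] -/
theorem exists_root_of_rtg {y : P} (h : Relation.ReflTransGen (EAdj E) p y) (hy : y ≠ p) :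
    ∃ r, EAdj E p r ∧ r ≠ p ∧ Relation.ReflTransGen (EAdj' E p) r y := by
  induction h with
  | refl => exact absurd rfl hy
  | @tail z w hpz hzw ih =>
    by_cases hz : z = p
    · subst hz; exact ⟨w, hzw, hy, Relation.ReflTransGen.refl⟩
    · obtain ⟨r, hpr, hr, hrz⟩ := ih hz
      exact ⟨r, hpr, hr, hrz.tail ⟨hzw, hz, hy⟩⟩

/-- Every branch contains a vertex adjacent to `p` (its root). [folklore] -/
theorem exists_root (hE : IsConnOn Y E) (hp : p ∈ Y) {K : Finset P} (hK : K ∈ branches Y E p) :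
    ∃ r ∈ K, EAdj E p r := by
  simp only [branches, mem_image] at hK
  obtain ⟨y, hy, rfl⟩ := hK
  have hy' := Finset.mem_erase.1 hy
  obtain ⟨r, hpr, hr, hry⟩ := exists_root_of_rtg (hE.2.2 p hp y hy'.2) hy'.1
  refine ⟨r, mem_comp.2 ⟨Finset.mem_erase.2 ⟨hr, (mem_of_eAdj hE hpr).2⟩, rtg'_symm hry⟩, hpr⟩

/-- A chosen root of a branch (junk `p` if none). [folklore] -/
def root (E : Finset (Sym2 P)) (p : P) (K : Finset P) : P :=
  if h : ∃ r ∈ K, EAdj E p r then h.choose else p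

/-- The chosen root lies in its branch and is adjacent to `p`. [folklore] -/
theorem root_spec (hE : IsConnOn Y E) (hp : p ∈ Y) {K : Finset P} (hK : K ∈ branches Y E p) :
    root E p K ∈ K ∧ EAdj E p (root E p K) := by
  have h := exists_root hE hp hK
  unfold root; rw [dif_pos h]; exact h.choose_spec

/-- A branch lies in `Y ∖ {p}`. [folklore] -/
theorem branch_subset {K : Finset P} (hK : K ∈ branches Y E p) : K ⊆ Y.erase p := by
  simp only [branches, mem_image] at hK
  obtain ⟨y, _, rfl⟩ := hK
  exact comp_subset y

/-- The edges of `E` away from `p` with both ends in the branch `K`. [folklore] -/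
def restr (E : Finset (Sym2 P)) (p : P) (K : Finset P) : Finset (Sym2 P) :=
  E.filter fun e => p ∉ e ∧ ∀ a ∈ e, a ∈ K

/-- A chain away from `p` starting in the branch `K = comp y₀` stays in `K` and uses only edges of `restr E p K`. [folklore] -/
theorem rtg_restr_of_rtg' (hE : IsConnOn Y E) {y₀ x v : P} (hx : x ∈ comp Y E p y₀)
    (h : Relation.ReflTransGen (EAdj' E p) x v) :
    v ∈ comp Y E p y₀ ∧ Relation.ReflTransGen (EAdj (restr E p (comp Y E p y₀))) x v := by
  induction h with
  | refl => exact ⟨hx, Relation.ReflTransGen.refl⟩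
  | @tail u v _ huv ih =>
    obtain ⟨hu, hxu⟩ := ih
    have hv : v ∈ comp Y E p y₀ :=
      mem_comp.2 ⟨Finset.mem_erase.2 ⟨huv.2.2, (mem_of_eAdj hE huv.1).2⟩, (mem_comp.1 hu).2.tail huv⟩
    refine ⟨hv, hxu.tail ?_⟩
    unfold EAdj restr
    rw [mem_filter]
    refine ⟨huv.1, fun hp => ?_, fun a ha => ?_⟩
    · rw [Sym2.mem_iff] at hp
      rcases hp with rfl | rfl
      · exact huv.2.1 rfl
      · exact huv.2.2 rfl
    · rw [Sym2.mem_iff] at ha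
      rcases ha with rfl | rfl
      · exact hu
      · exact hv

/-- A branch is connected by its own edges: `restr E p K` connects `K`. [folklore] -/
theorem restr_isConnOn (hE : IsConnOn Y E) {K : Finset P} (hK : K ∈ branches Y E p) :
    IsConnOn K (restr E p K) := by
  refine ⟨fun e he => Finset.mem_sym2_iff.2 (mem_filter.1 he).2.2, fun e he => hE.2.1 e (mem_filter.1 he).1,
    fun x hx y hy => ?_⟩
  simp only [branches, mem_image] at hK
  obtain ⟨y₀, _, rfl⟩ := hK
  have hxy : Relation.ReflTransGen (EAdj' E p) x y := (rtg'_symm (mem_comp.1 hx).2).trans (mem_comp.1 hy).2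
  exact (rtg_restr_of_rtg' hE hx hxy).2

/-- The restricted edge sets of distinct branches are disjoint. [folklore] -/
theorem disjoint_restr_of_ne {K K' : Finset P} (hK : K ∈ branches Y E p) (hK' : K' ∈ branches Y E p) (hne : K ≠ K') :
    Disjoint (restr E p K) (restr E p K') := by
  rw [Finset.disjoint_left]
  intro e he he'
  have h1 := (mem_filter.1 he).2.2
  have h2 := (mem_filter.1 he').2.2
  induction e using Sym2.ind with
  | h a b =>
    have ha : a ∈ K := h1 a (Sym2.mem_mk_left a b)
    have ha' : a ∈ K' := h2 a (Sym2.mem_mk_left a b)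
    exact Finset.disjoint_left.1 (pairwiseDisjoint_branches hK hK' hne) ha ha'

/-- The restricted edge sets lie among the edges of `E` not at `p`. [folklore] -/
theorem restr_subset (K : Finset P) : restr E p K ⊆ E.filter fun e => p ∉ e := by
  intro e he
  unfold restr at he
  rw [mem_filter] at he ⊢
  exact ⟨he.1, he.2.1⟩

/-- The root edges `s(p, r_K)` of distinct branches are distinct edges of `E` at `p`. [folklore] -/
theorem rootEdge_injOn (hE : IsConnOn Y E) (hp : p ∈ Y) :
    Set.InjOn (fun K => s(p, root E p K)) (branches Y E p : Set (Finset P)) := by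
  intro K hK K' hK' h
  by_contra hne
  have hr := (root_spec hE hp (Finset.mem_coe.1 hK)).1
  have hr' := (root_spec hE hp (Finset.mem_coe.1 hK')).1
  have heq : root E p K = root E p K' := by
    have := Sym2.eq_iff.1 h
    rcases this with ⟨_, h2⟩ | ⟨h1, h2⟩
    · exact h2
    · exact h2.trans h1
  exact Finset.disjoint_left.1 (pairwiseDisjoint_branches hK hK' hne) hr (heq ▸ hr')

/-- **THE GENERATION STEP** — removing the root `p` from a minimal connecting edge set: `ℓ′(Y) ≥ Σ_K (φ s(p,r_K) +
ℓ′(K))` over the branches `K` at `p` (edges at `p` other than the root edges and nothing else are dropped; `φ ≥ 0`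
off the diagonal).  This is the print's *"sum over the outer leaves of the tree working our way back to the root"*
read from the root. [cite: Dimock2013BalabanII, App. E proof of Lemma E.2 (arXiv:1212.5562v2 TeX L6866–6887)] -/
theorem treeLen'_ge_sum_branches {φ : Sym2 P → ℝ} (hφ : ∀ e, ¬e.IsDiag → 0 ≤ φ e) (hE : IsConnOn Y E)
    (hp : p ∈ Y) :
    ∑ K ∈ branches Y E p, (φ s(p, root E p K) + treeLen' φ K) ≤ wt φ E := by
  have hφE : ∀ e ∈ E, 0 ≤ φ e := fun e he => hφ e (hE.2.1 e he)
  rw [Finset.sum_add_distrib]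
  -- split `E` into the edges at `p` and the rest
  have hsplit : wt φ E = ∑ e ∈ E.filter (fun e => p ∈ e), φ e + ∑ e ∈ E.filter (fun e => p ∉ e), φ e := by
    unfold wt; rw [Finset.sum_filter_add_sum_filter_not]
  rw [hsplit]
  refine add_le_add ?_ ?_
  · -- root edges are distinct edges at `p`
    rw [← Finset.sum_image (f := φ) (rootEdge_injOn hE hp)]
    refine Finset.sum_le_sum_of_subset_of_nonneg (fun e he => ?_) fun e he _ => hφE e (mem_filter.1 he).1
    rw [mem_image] at he
    obtain ⟨K, hK, rfl⟩ := he
    exact mem_filter.2 ⟨(root_spec hE hp hK).2, Sym2.mem_mk_left _ _⟩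
  · -- each branch is connected by its own (pairwise disjoint) edges
    calc ∑ K ∈ branches Y E p, treeLen' φ K ≤ ∑ K ∈ branches Y E p, wt φ (restr E p K) :=
          Finset.sum_le_sum fun K hK => treeLen'_le_wt (restr_isConnOn hE hK)
      _ = ∑ e ∈ (branches Y E p).biUnion (restr E p), φ e := by
          unfold wt
          rw [Finset.sum_biUnion]
          intro K hK K' hK' hne
          exact disjoint_restr_of_ne (Finset.mem_coe.1 hK) (Finset.mem_coe.1 hK') hne
      _ ≤ ∑ e ∈ E.filter (fun e => p ∉ e), φ e := by
          refine Finset.sum_le_sum_of_subset_of_nonneg (fun e he => ?_) fun e he _ => hφE e (mem_filter.1 he).1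
          rw [mem_biUnion] at he
          obtain ⟨K, _, he⟩ := he
          exact restr_subset K he

end Branches

/-! ## Part 3. Lemma E.2 (1), abstract form: the tree-graph bound by generations -/

section TreeGraph

variable (φ : Sym2 P → ℝ)

/-- A chosen minimal connecting edge set of `Y`. [folklore] -/
def minConn (Y : Finset P) : Finset (Sym2 P) := (exists_conn_wt_eq φ Y).choose

/-- The chosen minimal edge set connects `Y`. [folklore] -/
theorem minConn_isConnOn (Y : Finset P) : IsConnOn Y (minConn φ Y) := (exists_conn_wt_eq φ Y).choose_spec.1

/-- The chosen minimal edge set has weight `ℓ′(Y)`. [folklore] -/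
theorem wt_minConn (Y : Finset P) : wt φ (minConn φ Y) = treeLen' φ Y := (exists_conn_wt_eq φ Y).choose_spec.2

/-- The code of `Y` at the base point `p`: its branches, each pointed at its root. [folklore] -/
def code (p : P) (Y : Finset P) : Finset (P × Finset P) :=
  (branches Y (minConn φ Y) p).image fun K => (root (minConn φ Y) p K, K)

variable {φ}

/-- An element `(r, K)` of the code: `r ∈ K`, `K ⊆ Y ∖ {p}`, `K` a branch. [folklore] -/
theorem mem_code {p : P} {Y : Finset P} (hp : p ∈ Y) {x : P × Finset P} (hx : x ∈ code φ p Y) :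
    x.1 ∈ x.2 ∧ x.2 ⊆ Y.erase p ∧ x.2 ∈ branches Y (minConn φ Y) p := by
  unfold code at hx
  rw [mem_image] at hx
  obtain ⟨K, hK, rfl⟩ := hx
  exact ⟨(root_spec (minConn_isConnOn φ Y) hp hK).1, branch_subset hK, hK⟩

/-- DECODING: `Y = {p} ∪ ⋃_K K` — the code is injective on sets containing `p`. [folklore] -/
theorem decode_code {p : P} {Y : Finset P} (hp : p ∈ Y) : insert p ((code φ p Y).biUnion Prod.snd) = Y := by
  have h1 : (code φ p Y).biUnion Prod.snd = (branches Y (minConn φ Y) p).biUnion id := by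
    unfold code; rw [Finset.image_biUnion]; rfl
  rw [h1, biUnion_branches, Finset.insert_erase hp]

/-- The code is injective on any family of sets containing `p`. [folklore] -/
theorem code_injOn (p : P) {𝒴 : Finset (Finset P)} (h𝒴 : ∀ Y ∈ 𝒴, p ∈ Y) :
    Set.InjOn (code φ p) (𝒴 : Set (Finset P)) := by
  intro Y hY Y' hY' h
  rw [← decode_code (φ := φ) (h𝒴 Y (Finset.mem_coe.1 hY)), ← decode_code (φ := φ) (h𝒴 Y' (Finset.mem_coe.1 hY')),
    h]

/-- The branch activity `a(r, K) = e^{−φ s(p,r)} e^{−ℓ′(K)}`. [folklore] -/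
def act (φ : Sym2 P → ℝ) (p : P) (x : P × Finset P) : ℝ := exp (-φ s(p, x.1)) * exp (-treeLen' φ x.2)

/-- Branch activities are non-negative. [folklore] -/
theorem act_nonneg (φ : Sym2 P → ℝ) (p : P) (x : P × Finset P) : 0 ≤ act φ p x :=
  mul_nonneg (exp_pos _).le (exp_pos _).le

/-- PER-SET BOUND: `e^{−ℓ′(Y)} ≤ Π_{(r,K) ∈ code Y} e^{−φ s(p,r)} e^{−ℓ′(K)}` (the generation step exponentiated). [folklore] -/
theorem exp_neg_treeLen'_le_prod_code (hφ : ∀ e, ¬e.IsDiag → 0 ≤ φ e) {p : P} {Y : Finset P} (hp : p ∈ Y) :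
    exp (-treeLen' φ Y) ≤ ∏ x ∈ code φ p Y, act φ p x := by
  have hge := treeLen'_ge_sum_branches hφ (minConn_isConnOn φ Y) hp
  rw [wt_minConn] at hge
  have hinj : Set.InjOn (fun K => (root (minConn φ Y) p K, K)) (branches Y (minConn φ Y) p : Set (Finset P)) := by
    intro K _ K' _ h; exact (Prod.mk.inj h).2
  unfold code
  rw [Finset.prod_image hinj]
  simp only [act, ← Real.exp_add, ← Real.exp_sum]
  refine Real.exp_le_exp.2 ?_
  have : ∑ K ∈ branches Y (minConn φ Y) p, (-φ s(p, root (minConn φ Y) p K) + -treeLen' φ K) =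
      -∑ K ∈ branches Y (minConn φ Y) p, (φ s(p, root (minConn φ Y) p K) + treeLen' φ K) := by
    rw [← Finset.sum_neg_distrib]; refine Finset.sum_congr rfl fun K _ => by ring
  rw [this]; linarith

/-- `Π (1 + a) ≤ exp(Σ a)` for `a ≥ 0`, in the form `Σ_{𝒞 ⊆ Q} Π_{𝒞} a ≤ exp(Σ_Q a)` (`Finset.prod_one_add`): sums
over SETS of distinct branches need no `1/n!`. [folklore] -/
theorem sum_powerset_prod_le_exp' {α : Type*} (s : Finset α) (f : α → ℝ) (hf : ∀ i ∈ s, 0 ≤ f i) :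
    ∑ t ∈ s.powerset, ∏ i ∈ t, f i ≤ exp (∑ i ∈ s, f i) := by
  rw [← Finset.prod_one_add, Real.exp_sum]
  exact Finset.prod_le_prod (fun i hi => by linarith [hf i hi]) fun i hi => by linarith [Real.add_one_le_exp (f i)]

/-- THE GENERATION STEP OF THE INDUCTION. [folklore] -/
theorem sum_exp_neg_treeLen'_step (hφ : ∀ e, ¬e.IsDiag → 0 ≤ φ e) {w b : ℝ} (hb0 : 0 ≤ b)
    (hone : ∀ (p : P) (S : Finset P), p ∉ S → ∑ q ∈ S, exp (-φ s(p, q)) ≤ w) (hb : exp (w * b) ≤ b) {n : ℕ}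
    (IH : ∀ (r : P) (𝒦 : Finset (Finset P)), (∀ K ∈ 𝒦, r ∈ K ∧ K.card ≤ n + 1) →
      ∑ K ∈ 𝒦, exp (-treeLen' φ K) ≤ b)
    (p : P) (𝒴 : Finset (Finset P)) (h𝒴 : ∀ Y ∈ 𝒴, p ∈ Y ∧ Y.card ≤ n + 2) :
    ∑ Y ∈ 𝒴, exp (-treeLen' φ Y) ≤ b := by
  have hpY : ∀ Y ∈ 𝒴, p ∈ Y := fun Y hY => (h𝒴 Y hY).1
  set Q : Finset (P × Finset P) := 𝒴.biUnion (code φ p) with hQ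
  -- (i) per-set bound and injectivity of the code
  have h1 : ∑ Y ∈ 𝒴, exp (-treeLen' φ Y) ≤ ∑ 𝒞 ∈ 𝒴.image (code φ p), ∏ x ∈ 𝒞, act φ p x := by
    rw [Finset.sum_image (code_injOn p hpY)]
    exact Finset.sum_le_sum fun Y hY => exp_neg_treeLen'_le_prod_code hφ (hpY Y hY)
  -- (ii) enlarge to all sub-collections of Q and resum
  have h2 : ∑ 𝒞 ∈ 𝒴.image (code φ p), ∏ x ∈ 𝒞, act φ p x ≤ ∑ 𝒞 ∈ Q.powerset, ∏ x ∈ 𝒞, act φ p x := by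
    refine Finset.sum_le_sum_of_subset_of_nonneg (fun 𝒞 h𝒞 => ?_) fun 𝒞 _ _ =>
      Finset.prod_nonneg fun x _ => act_nonneg φ p x
    rw [mem_image] at h𝒞
    obtain ⟨Y, hY, rfl⟩ := h𝒞
    exact Finset.mem_powerset.2 (Finset.subset_biUnion_of_mem (code φ p) hY)
  have h3 : ∑ 𝒞 ∈ Q.powerset, ∏ x ∈ 𝒞, act φ p x ≤ exp (∑ x ∈ Q, act φ p x) :=
    sum_powerset_prod_le_exp' Q (act φ p) fun x _ => act_nonneg φ p x
  -- (iii) the activities of Q sum to at most `w·b`: group by the root and use the induction hypothesis there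
  have h4 : ∑ x ∈ Q, act φ p x ≤ w * b := by
    set R : Finset P := Q.image Prod.fst with hR
    have hfib : ∑ x ∈ Q, act φ p x = ∑ r ∈ R, ∑ x ∈ Q.filter (fun x => x.1 = r), act φ p x :=
      (Finset.sum_fiberwise_of_maps_to (fun x hx => Finset.mem_image_of_mem Prod.fst hx) (act φ p)).symm
    rw [hfib]
    have hinner : ∀ r ∈ R, ∑ x ∈ Q.filter (fun x => x.1 = r), act φ p x ≤ exp (-φ s(p, r)) * b := by
      intro r _
      have heq : ∑ x ∈ Q.filter (fun x => x.1 = r), act φ p x =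
          exp (-φ s(p, r)) * ∑ x ∈ Q.filter (fun x => x.1 = r), exp (-treeLen' φ x.2) := by
        rw [Finset.mul_sum]
        refine Finset.sum_congr rfl fun x hx => ?_
        rw [(mem_filter.1 hx).2.symm]; rfl
      rw [heq]
      refine mul_le_mul_of_nonneg_left ?_ (exp_pos _).le
      -- the fibre over `r`, read through its second components, is a family of sets containing `r` of size ≤ n+1
      have hinj : Set.InjOn Prod.snd (Q.filter (fun x => x.1 = r) : Set (P × Finset P)) := by
        intro x hx x' hx' h
        have e1 := (mem_filter.1 (Finset.mem_coe.1 hx)).2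
        have e2 := (mem_filter.1 (Finset.mem_coe.1 hx')).2
        exact Prod.ext (e1.trans e2.symm) h
      rw [← Finset.sum_image (f := fun K => exp (-treeLen' φ K)) hinj]
      refine IH r _ fun K hK => ?_
      rw [mem_image] at hK
      obtain ⟨x, hx, rfl⟩ := hK
      obtain ⟨hxQ, hxr⟩ := mem_filter.1 hx
      rw [hQ, mem_biUnion] at hxQ
      obtain ⟨Y, hY, hxY⟩ := hxQ
      obtain ⟨hmem, hsub, _⟩ := mem_code (hpY Y hY) hxY
      refine ⟨hxr ▸ hmem, ?_⟩
      -- #K ≤ #(Y.erase p) = #Y - 1 ≤ n + 1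
      have h' : x.2.card ≤ (Y.erase p).card := Finset.card_le_card hsub
      rw [Finset.card_erase_of_mem (hpY Y hY)] at h'
      have hY2 := (h𝒴 Y hY).2
      omega
    calc ∑ r ∈ R, ∑ x ∈ Q.filter (fun x => x.1 = r), act φ p x ≤ ∑ r ∈ R, exp (-φ s(p, r)) * b :=
          Finset.sum_le_sum hinner
      _ = (∑ r ∈ R, exp (-φ s(p, r))) * b := by rw [Finset.sum_mul]
      _ ≤ w * b := by
          refine mul_le_mul_of_nonneg_right (hone p R fun hpR => ?_) hb0
          rw [hR, mem_image] at hpR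
          obtain ⟨x, hx, hxp⟩ := hpR
          rw [hQ, mem_biUnion] at hx
          obtain ⟨Y, hY, hxY⟩ := hx
          obtain ⟨hmem, hsub, _⟩ := mem_code (hpY Y hY) hxY
          have := hsub hmem
          rw [hxp, Finset.mem_erase] at this
          exact this.1 rfl
  calc ∑ Y ∈ 𝒴, exp (-treeLen' φ Y) ≤ exp (∑ x ∈ Q, act φ p x) := h1.trans (h2.trans h3)
    _ ≤ exp (w * b) := Real.exp_le_exp.2 h4
    _ ≤ b := hb

/-- **LEMMA E.2 (1), ABSTRACT FORM — THE TREE-GRAPH BOUND** — [Dimock2013BalabanII] App. E, verbatim: *"There are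
constants a′, b′ = 𝒪(1) such that for any M-cube □₀  Σ_{Y : Y ⊃ □₀} exp(−a′ℓ′_M(Y)) ≤ b′"* — PROVED for an
arbitrary vertex type and weight `φ ≥ 0` (the `a′` absorbed in `φ`): if the one-vertex sums obey *"Σ_{□′ ≠ □}
exp(−a′d′(□,□′)) ≤"* `w` uniformly and `exp(w b) ≤ b`, then `Σ_{Y∈𝒴} exp(−ℓ′(Y)) ≤ b` for every vertex `p` and every
finite family `𝒴` of finite sets containing `p`.  Induction on `#Y` by the generation step (DEVIATION from the
print's Cayley count declared in the header). [cite: Dimock2013BalabanII, App. E Lemma E.2 (1) (arXiv:1212.5562v2 TeX L6833–6839, proof L6856–6893)] -/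
theorem sum_exp_neg_treeLen'_le (hφ : ∀ e, ¬e.IsDiag → 0 ≤ φ e) {w b : ℝ}
    (hone : ∀ (p : P) (S : Finset P), p ∉ S → ∑ q ∈ S, exp (-φ s(p, q)) ≤ w) (hb : exp (w * b) ≤ b)
    (p : P) (𝒴 : Finset (Finset P)) (h𝒴 : ∀ Y ∈ 𝒴, p ∈ Y) :
    ∑ Y ∈ 𝒴, exp (-treeLen' φ Y) ≤ b := by
  have hb0 : 0 < b := lt_of_lt_of_le (exp_pos _) hb
  have hw : 0 ≤ w := by
    have := hone p ∅ (Finset.notMem_empty p)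
    simpa using this
  have hb1 : 1 ≤ b := (Real.one_le_exp (mul_nonneg hw hb0.le)).trans hb
  -- induction on the size bound
  suffices H : ∀ (n : ℕ) (r : P) (𝒦 : Finset (Finset P)), (∀ K ∈ 𝒦, r ∈ K ∧ K.card ≤ n + 1) →
      ∑ K ∈ 𝒦, exp (-treeLen' φ K) ≤ b by
    refine H (𝒴.sup Finset.card) p 𝒴 fun Y hY => ⟨h𝒴 Y hY, ?_⟩
    exact (Finset.le_sup (f := Finset.card) hY).trans (Nat.le_succ _)
  intro n
  induction n with
  | zero =>
    intro r 𝒦 h𝒦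
    have hsub : 𝒦 ⊆ {{r}} := by
      intro K hK
      rw [Finset.mem_singleton]
      obtain ⟨hr, hc⟩ := h𝒦 K hK
      exact Finset.eq_singleton_iff_unique_mem.2 ⟨hr, fun x hx => Finset.card_le_one.1 (by omega) x hx r hr⟩
    calc ∑ K ∈ 𝒦, exp (-treeLen' φ K) ≤ ∑ K ∈ ({{r}} : Finset (Finset P)), exp (-treeLen' φ K) :=
          Finset.sum_le_sum_of_subset_of_nonneg hsub fun _ _ _ => (exp_pos _).le
      _ = 1 := by rw [Finset.sum_singleton, treeLen'_singleton, neg_zero, Real.exp_zero]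
      _ ≤ b := hb1
  | succ n ih =>
    intro r 𝒦 h𝒦
    exact sum_exp_neg_treeLen'_step hφ hb0.le hone hb ih r 𝒦 h𝒦

end TreeGraph

/-! ## Part 3b. The lattice shadow of Lemma E.1: a connecting edge set has at least `#Y − 1` edges -/

section Volume

/-- With unit weights, `ℓ′(Y) ≥ #Y − 1`: a connecting edge set on `Y` has at least `#Y − 1` edges (by generations:
`#E ≥ Σ_K (1 + #E|_K)`). [folklore] -/
theorem card_sub_one_le_treeLen'_one (Y : Finset P) : (Y.card : ℝ) - 1 ≤ treeLen' (fun _ => (1 : ℝ)) Y := by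
  induction Y using Finset.strongInduction with
  | H Y ih =>
    rcases Y.eq_empty_or_nonempty with rfl | ⟨p, hp⟩
    · simp only [Finset.card_empty, Nat.cast_zero, zero_sub]
      linarith [treeLen'_nonneg (φ := fun _ : Sym2 P => (1 : ℝ)) (fun _ _ => zero_le_one) (∅ : Finset P)]
    · have hge := treeLen'_ge_sum_branches (φ := fun _ => (1 : ℝ)) (fun _ _ => zero_le_one)
        (minConn_isConnOn (fun _ => (1 : ℝ)) Y) hp
      rw [wt_minConn] at hge
      have hK : ∀ K ∈ branches Y (minConn (fun _ => (1 : ℝ)) Y) p, (K.card : ℝ) ≤ 1 + treeLen' (fun _ => (1 : ℝ)) K := by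
        intro K hK
        have hKY : K ⊂ Y :=
          Finset.ssubset_of_subset_of_ssubset (branch_subset hK) (Finset.erase_ssubset hp)
        linarith [ih K hKY]
      have hcard : ((Y.erase p).card : ℝ) = ∑ K ∈ branches Y (minConn (fun _ => (1 : ℝ)) Y) p, (K.card : ℝ) := by
        rw [← biUnion_branches (E := minConn (fun _ => (1 : ℝ)) Y), Finset.card_biUnion pairwiseDisjoint_branches]
        push_cast
        rfl
      rw [Finset.card_erase_of_mem hp, Nat.cast_sub (Finset.card_pos.2 ⟨p, hp⟩), Nat.cast_one] at hcard
      rw [hcard]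
      exact (Finset.sum_le_sum hK).trans hge

/-- A connecting edge set on `Y` has at least `#Y − 1` edges. [folklore] -/
theorem card_sub_one_le_card_of_isConnOn {Y : Finset P} {E : Finset (Sym2 P)} (hE : IsConnOn Y E) :
    (Y.card : ℝ) - 1 ≤ E.card := by
  have h := treeLen'_le_wt (φ := fun _ => (1 : ℝ)) hE
  unfold wt at h
  rw [Finset.sum_const, nsmul_eq_mul, mul_one] at h
  exact (card_sub_one_le_treeLen'_one Y).trans h

/-- If every off-diagonal weight is at least `m ≥ 0` then `ℓ′(Y) ≥ m(#Y − 1)`. [folklore] -/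
theorem mul_card_sub_one_le_treeLen' {φ : Sym2 P → ℝ} {m : ℝ} (hm : 0 ≤ m) (hφ : ∀ e, ¬e.IsDiag → m ≤ φ e)
    (Y : Finset P) : m * ((Y.card : ℝ) - 1) ≤ treeLen' φ Y := by
  refine le_treeLen' fun E hE => ?_
  calc m * ((Y.card : ℝ) - 1) ≤ m * E.card := mul_le_mul_of_nonneg_left (card_sub_one_le_card_of_isConnOn hE) hm
    _ = ∑ _e ∈ E, m := by rw [Finset.sum_const, nsmul_eq_mul, mul_comm]
    _ ≤ wt φ E := Finset.sum_le_sum fun e he => hφ e (hE.2.1 e he)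

end Volume

/-! ## Part 4. Lemma E.2 (2) from (1): the printed arithmetic, model-free -/

section PartTwo

/-- ONE TERM: with the shapes of Lemma E.1 (2) `ℓ′ ≤ ℓ + v` and (3) `v ≤ c(ℓ + 1)` (`v = |Y|`), `exp(−aℓ) ≤
e^{ca/(1+c)} exp(−(a/(1+c))ℓ′)` — the step *"exp(−(a−a′)ℓ(Y) + a′|Y| − a′ℓ′(Y)) ≤ 𝒪(1) exp(−(a−𝒪(1))ℓ(Y))
exp(−a′ℓ′(Y))"* with `a′ = a/(1+c)` and the `𝒪(1)`'s explicit. [cite: Dimock2013BalabanII, App. E proof of Lemma E.2 (2) (arXiv:1212.5562v2 TeX L6896–6908)] -/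
theorem exp_neg_ell_le {a c ℓ ℓ' v : ℝ} (ha : 0 ≤ a) (hc : 0 ≤ c) (h2 : ℓ' ≤ ℓ + v) (h3 : v ≤ c * (ℓ + 1)) :
    exp (-(a * ℓ)) ≤ exp (c * a / (1 + c)) * exp (-(a / (1 + c) * ℓ')) := by
  rw [← Real.exp_add]
  refine Real.exp_le_exp.2 ?_
  have h1c : 0 < 1 + c := by linarith
  have hl : ℓ' - c ≤ (1 + c) * ℓ := by nlinarith
  have hdiv : (ℓ' - c) / (1 + c) ≤ ℓ := by rw [div_le_iff₀ h1c]; linarith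
  have := mul_le_mul_of_nonneg_left hdiv ha
  have e1 : a * ((ℓ' - c) / (1 + c)) = a / (1 + c) * ℓ' - c * a / (1 + c) := by field_simp
  linarith

/-- **LEMMA E.2 (2) FROM (1)** — [Dimock2013BalabanII] App. E, verbatim: *"There are constants a, b = 𝒪(1) such
that Σ_{Y : Y ⊃ □₀} exp(−aℓ_M(Y)) ≤ b"*, *"Using the second and third bound in lemma* [E.1] *we have for a, b
sufficiently large … ≤ 𝒪(1) Σ_{Y : Y ⊃ □₀} exp(−a′ℓ′(Y)) ≤ b"* — PROVED as model-free arithmetic over an arbitrary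
finite family, the shapes E.1 (2),(3) as hypotheses: `Σ exp(−aℓ) ≤ e^{ca/(1+c)}·b′` from `Σ exp(−(a/(1+c))ℓ′) ≤ b′`.
[cite: Dimock2013BalabanII, App. E Lemma E.2 (2) (arXiv:1212.5562v2 TeX L6840–6845, proof L6896–6908)] -/
theorem kumquat_two_of_one {ι : Type*} (𝒴 : Finset ι) (ℓ ℓ' v : ι → ℝ) {a c b' : ℝ} (ha : 0 ≤ a) (hc : 0 ≤ c)
    (h2 : ∀ Y ∈ 𝒴, ℓ' Y ≤ ℓ Y + v Y) (h3 : ∀ Y ∈ 𝒴, v Y ≤ c * (ℓ Y + 1))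
    (h1 : ∑ Y ∈ 𝒴, exp (-(a / (1 + c) * ℓ' Y)) ≤ b') :
    ∑ Y ∈ 𝒴, exp (-(a * ℓ Y)) ≤ exp (c * a / (1 + c)) * b' := by
  calc ∑ Y ∈ 𝒴, exp (-(a * ℓ Y)) ≤ ∑ Y ∈ 𝒴, exp (c * a / (1 + c)) * exp (-(a / (1 + c) * ℓ' Y)) :=
        Finset.sum_le_sum fun Y hY => exp_neg_ell_le ha hc (h2 Y hY) (h3 Y hY)
    _ = exp (c * a / (1 + c)) * ∑ Y ∈ 𝒴, exp (-(a / (1 + c) * ℓ' Y)) := by rw [Finset.mul_sum]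
    _ ≤ exp (c * a / (1 + c)) * b' := mul_le_mul_of_nonneg_left h1 (exp_pos _).le

end PartTwo

/-! ## Part 5. The printed instance: blocks of `ℤ^d`, the sup metric on centres, explicit `a′, b′` -/

section Lattice

variable {d : ℕ}

/-- The sup distance between centres (L6811 *"We use the metric |x−y| = sup_μ|x_μ − y_μ|"*), ℕ-valued on `ℤ^d`.
[cite: Dimock2013BalabanII, App. E (arXiv:1212.5562v2 TeX L6811)] -/
def supDist (x y : Fin d → ℤ) : ℕ := Finset.univ.sup fun i => (x i - y i).natAbs

/-- The sup distance is symmetric. [folklore] -/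
theorem supDist_comm (x y : Fin d → ℤ) : supDist x y = supDist y x := by
  unfold supDist; congr 1; funext i; rw [← Int.natAbs_neg, neg_sub]

/-- `d′(x,y) ≤ s` iff every coordinate differs by at most `s`. [folklore] -/
theorem supDist_le_iff {x y : Fin d → ℤ} {s : ℕ} : supDist x y ≤ s ↔ ∀ i, (x i - y i).natAbs ≤ s := by
  unfold supDist; rw [Finset.sup_le_iff]; simp

/-- Distinct centres are at sup distance at least `1`. [folklore] -/
theorem one_le_supDist {x y : Fin d → ℤ} (h : x ≠ y) : 1 ≤ supDist x y := by
  by_contra hlt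
  have h0 : supDist x y ≤ 0 := by omega
  rw [supDist_le_iff] at h0
  exact h (funext fun i => by have := h0 i; omega)

/-- The sup-metric box of radius `s` about `p`. [folklore] -/
def box (p : Fin d → ℤ) (s : ℕ) : Finset (Fin d → ℤ) := Fintype.piFinset fun i => Finset.Icc (p i - s) (p i + s)

/-- Membership in the box: `x ∈ box p s ↔ d′(x,p) ≤ s`. [folklore] -/
theorem mem_box {p x : Fin d → ℤ} {s : ℕ} : x ∈ box p s ↔ supDist x p ≤ s := by
  unfold box
  rw [Fintype.mem_piFinset, supDist_le_iff]
  refine forall_congr' fun i => ?_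
  rw [Finset.mem_Icc]
  omega

/-- `#{x : d′(x,p) ≤ s} = (2s+1)^d`. [folklore] -/
theorem card_box (p : Fin d → ℤ) (s : ℕ) : (box p s).card = (2 * s + 1) ^ d := by
  unfold box
  rw [Fintype.card_piFinset]
  have h : ∀ i, (Finset.Icc (p i - s) (p i + s)).card = 2 * s + 1 := fun i => by
    rw [Int.card_Icc]; omega
  simp_rw [h, Finset.prod_const, Finset.card_univ, Fintype.card_fin]

/-- `2s + 1 ≤ 3^s` for `s ≥ 1`. [folklore] -/
theorem two_mul_add_one_le_three_pow {s : ℕ} (hs : 1 ≤ s) : 2 * s + 1 ≤ 3 ^ s := by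
  induction s with
  | zero => omega
  | succ n ih =>
    rcases Nat.eq_zero_or_pos n with rfl | hn
    · norm_num
    · have := ih hn
      rw [pow_succ]; omega

/-- The weight `φ = a′·d′` on pairs of centres. [folklore] -/
def phiZ (a : ℝ) : Sym2 (Fin d → ℤ) → ℝ :=
  Sym2.lift ⟨fun x y => a * (supDist x y : ℝ), fun x y => by simp only [supDist_comm]⟩

/-- `φ_{a′} s(x,y) = a′·d′(x,y)`. [folklore] -/
@[simp] theorem phiZ_mk (a : ℝ) (x y : Fin d → ℤ) : phiZ a s(x, y) = a * (supDist x y : ℝ) := rfl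

/-- `φ_{a′} ≥ 0` for `a′ ≥ 0`. [folklore] -/
theorem phiZ_nonneg {a : ℝ} (ha : 0 ≤ a) (e : Sym2 (Fin d → ℤ)) : 0 ≤ phiZ a e := by
  induction e using Sym2.ind with
  | h x y => rw [phiZ_mk]; positivity

/-- Off the diagonal `φ_{a′} ≥ a′` (distinct centres are at distance `≥ 1`). [folklore] -/
theorem le_phiZ_of_not_isDiag {a : ℝ} (ha : 0 ≤ a) (e : Sym2 (Fin d → ℤ)) (he : ¬e.IsDiag) : a ≤ phiZ a e := by
  induction e using Sym2.ind with
  | h x y =>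
    rw [Sym2.mk_isDiag_iff] at he
    rw [phiZ_mk]
    have : (1 : ℝ) ≤ supDist x y := by exact_mod_cast one_le_supDist he
    nlinarith

/-- **`ℓ′(Y) ≥ #Y − 1`** on the lattice (in units of `a′`: `ℓ′_{a′}(Y) ≥ a′(#Y − 1)`) — the lattice shadow of Lemma
E.1 (3) (every edge between distinct centres has `d′ ≥ 1`). [folklore] -/
theorem card_sub_one_le_treeLen' {a : ℝ} (ha : 0 ≤ a) (Y : Finset (Fin d → ℤ)) :
    a * ((Y.card : ℝ) - 1) ≤ treeLen' (phiZ a) Y :=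
  mul_card_sub_one_le_treeLen' ha (le_phiZ_of_not_isDiag ha) Y

/-- THE ONE-VERTEX BOUND WITH ITS CONSTANT — the print's *"Σ_{□′: □′ ≠ □} exp(−a′d′(□,□′)) ≤ 𝒪(1)e^{−a′}"* in the
explicit form: if `3^d e^{−a′} ≤ 1/8` then `Σ_{q∈S} exp(−a′d′(p,q)) ≤ 1/7` for every finite `S ∌ p` (shells:
`#{d′ = s} ≤ (2s+1)^d ≤ 3^{ds}`, geometric series `Σ_{s≥1} q^s ≤ q/(1−q)`).
[cite: Dimock2013BalabanII, App. E proof of Lemma E.2 (1) (arXiv:1212.5562v2 TeX L6883–6886)] -/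
theorem one_vertex_sum_le {a : ℝ} (ha : (3 : ℝ) ^ d * exp (-a) ≤ 1 / 8) (p : Fin d → ℤ)
    (S : Finset (Fin d → ℤ)) (hp : p ∉ S) : ∑ q ∈ S, exp (-phiZ a s(p, q)) ≤ 1 / 7 := by
  set q : ℝ := (3 : ℝ) ^ d * exp (-a) with hq
  have hq0 : 0 ≤ q := by positivity
  have hq1 : q < 1 := by linarith
  -- group `S` by the distance to `p`
  set N : ℕ := S.sup fun x => supDist x p with hN
  have hmaps : ∀ x ∈ S, supDist x p ∈ Finset.Ico 1 (N + 1) := by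
    intro x hx
    rw [Finset.mem_Ico]
    refine ⟨one_le_supDist fun h => hp (h ▸ hx), Nat.lt_succ_of_le ?_⟩
    exact Finset.le_sup (f := fun x => supDist x p) hx
  rw [← Finset.sum_fiberwise_of_maps_to hmaps]
  -- each shell contributes at most `q^s`
  have hshell : ∀ s ∈ Finset.Ico 1 (N + 1),
      ∑ x ∈ S.filter (fun x => supDist x p = s), exp (-phiZ a s(p, x)) ≤ q ^ s := by
    intro s hs
    have hs1 : 1 ≤ s := (Finset.mem_Ico.1 hs).1
    have hterm : ∀ x ∈ S.filter (fun x => supDist x p = s), exp (-phiZ a s(p, x)) = exp (-a) ^ s := by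
      intro x hx
      rw [phiZ_mk, supDist_comm, (mem_filter.1 hx).2, ← Real.exp_nat_mul]; ring_nf
    rw [Finset.sum_congr rfl hterm, Finset.sum_const, nsmul_eq_mul]
    have hcard : ((S.filter (fun x => supDist x p = s)).card : ℝ) ≤ (3 : ℝ) ^ (d * s) := by
      have h1 : (S.filter (fun x => supDist x p = s)).card ≤ (box p s).card :=
        Finset.card_le_card fun x hx => mem_box.2 (le_of_eq (mem_filter.1 hx).2)
      rw [card_box] at h1
      have h2 : (2 * s + 1) ^ d ≤ 3 ^ (d * s) := by
        rw [pow_mul']; exact Nat.pow_le_pow_left (two_mul_add_one_le_three_pow hs1) d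
      exact_mod_cast h1.trans h2
    calc ((S.filter (fun x => supDist x p = s)).card : ℝ) * exp (-a) ^ s ≤ (3 : ℝ) ^ (d * s) * exp (-a) ^ s :=
          mul_le_mul_of_nonneg_right hcard (by positivity)
      _ = q ^ s := by rw [hq, mul_pow, pow_mul]
  calc ∑ s ∈ Finset.Ico 1 (N + 1), ∑ x ∈ S.filter (fun x => supDist x p = s), exp (-phiZ a s(p, x))
        ≤ ∑ s ∈ Finset.Ico 1 (N + 1), q ^ s := Finset.sum_le_sum hshell
    _ ≤ q ^ 1 / (1 - q) := geom_sum_Ico_le_of_lt_one hq0 hq1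
    _ ≤ 1 / 7 := by
        rw [pow_one, div_le_div_iff₀ (by linarith) (by norm_num)]
        linarith

/-- `exp(2/7) ≤ 2`. [folklore] -/
theorem exp_two_sevenths_le_two : exp ((1 / 7 : ℝ) * 2) ≤ 2 := by
  have h : (1 / 7 : ℝ) * 2 ≤ Real.log 2 := by linarith [Real.log_two_gt_d9]
  calc exp ((1 / 7 : ℝ) * 2) ≤ exp (Real.log 2) := Real.exp_le_exp.2 h
    _ = 2 := Real.exp_log (by norm_num)

/-- *"a′ sufficiently large"*: `a′ ≥ log 8 + d log 3` gives `3^d e^{−a′} ≤ 1/8`. [folklore] -/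
theorem three_pow_mul_exp_neg_le {a : ℝ} (ha : Real.log 8 + d * Real.log 3 ≤ a) :
    (3 : ℝ) ^ d * exp (-a) ≤ 1 / 8 := by
  have h3 : (3 : ℝ) ^ d = exp (d * Real.log 3) := by
    rw [← Real.exp_log (by positivity : (0 : ℝ) < 3 ^ d), Real.log_pow]
  rw [h3, ← Real.exp_add]
  calc exp (d * Real.log 3 + -a) ≤ exp (-Real.log 8) := Real.exp_le_exp.2 (by linarith)
    _ = 1 / 8 := by rw [Real.exp_neg, Real.exp_log (by norm_num)]; norm_num

/-- The threshold forces `a′ ≥ 0` (indeed `a′ ≥ log 8`). [folklore] -/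
theorem nonneg_of_threshold {a : ℝ} (ha : (3 : ℝ) ^ d * exp (-a) ≤ 1 / 8) : 0 ≤ a := by
  by_contra h
  have h1 : (1 : ℝ) ≤ exp (-a) := Real.one_le_exp (by linarith)
  have h3 : (1 : ℝ) ≤ (3 : ℝ) ^ d := one_le_pow₀ (by norm_num)
  nlinarith

/-- **LEMMA E.2 (1) ON THE LATTICE, EXPLICIT CONSTANTS** — [Dimock2013BalabanII] App. E, verbatim: *"There are
constants a′, b′ = 𝒪(1) such that for any M-cube □₀  Σ_{Y : Y ⊃ □₀} exp(−a′ℓ′_M(Y)) ≤ b′"* — PROVED for the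
blocks of `ℤ^d` (centres, sup metric) with `b′ = 2` whenever `3^d e^{−a′} ≤ 1/8` (e.g. `a′ ≥ log 8 + d log 3`,
`three_pow_mul_exp_neg_le`; the threshold forces `a′ > 0`): for every centre `x₀` and every finite family `𝒴` of
finite `Y ∋ x₀`,
`Σ_{Y∈𝒴} exp(−a′ℓ′(Y)) ≤ 2` (`ℓ′` = `treeLen' (phiZ a′)`, the `a′` inside).
[cite: Dimock2013BalabanII, App. E Lemma E.2 (1) (arXiv:1212.5562v2 TeX L6833–6839)] -/
theorem kumquat_one {a : ℝ} (ha : (3 : ℝ) ^ d * exp (-a) ≤ 1 / 8) (x₀ : Fin d → ℤ)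
    (𝒴 : Finset (Finset (Fin d → ℤ))) (h𝒴 : ∀ Y ∈ 𝒴, x₀ ∈ Y) :
    ∑ Y ∈ 𝒴, exp (-treeLen' (phiZ a) Y) ≤ 2 :=
  sum_exp_neg_treeLen'_le (fun e _ => phiZ_nonneg (nonneg_of_threshold ha) e) (w := 1 / 7) (b := 2)
    (fun p S hp => one_vertex_sum_le ha p S hp) exp_two_sevenths_le_two x₀ 𝒴 h𝒴

/-- Changing `a′`: on a fixed edge set, `wt (phiZ a) E = a · wt (phiZ 1) E`. [folklore] -/
theorem wt_phiZ (a : ℝ) (E : Finset (Sym2 (Fin d → ℤ))) : wt (phiZ a) E = a * wt (phiZ 1) E := by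
  unfold wt; rw [Finset.mul_sum]
  refine Finset.sum_congr rfl fun e _ => ?_
  induction e using Sym2.ind with
  | h x y => simp [phiZ_mk]

/-- **THE VOLUME-WEIGHTED FORM** — activities growing like `e^{c|Y|}` are summable against tree decay: for `c ≥ 0`
and `3^d e^{−(a−c)} ≤ 1/8`, `Σ_{Y∈𝒴} exp(−aℓ′(Y) + c(#Y − 1)) ≤ 2` (via `ℓ′ ≥ #Y − 1`: `−ℓ′_a + c(#Y−1) ≤
−ℓ′_{a−c}`) — the shape *"exp(−½κ₀ℓ_M(Y) + 𝒪(1)|Y|_M) … if κ₀ is large enough"* of the proof of Lemma E.3.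
[cite: Dimock2013BalabanII, App. E proof of Lemma E.3 (arXiv:1212.5562v2 TeX L6946–6955)] -/
theorem kumquat_one_volume {a c : ℝ} (hc : 0 ≤ c) (ha : (3 : ℝ) ^ d * exp (-(a - c)) ≤ 1 / 8)
    (x₀ : Fin d → ℤ) (𝒴 : Finset (Finset (Fin d → ℤ))) (h𝒴 : ∀ Y ∈ 𝒴, x₀ ∈ Y) :
    ∑ Y ∈ 𝒴, exp (-treeLen' (phiZ a) Y + c * ((Y.card : ℝ) - 1)) ≤ 2 := by
  have hper : ∀ Y ∈ 𝒴, exp (-treeLen' (phiZ a) Y + c * ((Y.card : ℝ) - 1)) ≤ exp (-treeLen' (phiZ (a - c)) Y) := by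
    intro Y _
    refine Real.exp_le_exp.2 ?_
    set E := minConn (phiZ a) Y
    have hE : IsConnOn Y E := minConn_isConnOn (phiZ a) Y
    have h1 : treeLen' (phiZ (a - c)) Y ≤ wt (phiZ (a - c)) E := treeLen'_le_wt hE
    have h2 : wt (phiZ a) E = treeLen' (phiZ a) Y := wt_minConn (phiZ a) Y
    have h3 : ((Y.card : ℝ) - 1) ≤ wt (phiZ 1) E := by
      have := mul_card_sub_one_le_treeLen' zero_le_one (le_phiZ_of_not_isDiag (d := d) zero_le_one) Y
      rw [one_mul] at this
      exact this.trans (treeLen'_le_wt hE)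
    rw [wt_phiZ (a - c), sub_mul] at h1
    rw [wt_phiZ a] at h2
    nlinarith
  refine (Finset.sum_le_sum hper).trans ?_
  exact kumquat_one ha x₀ 𝒴 h𝒴

end Lattice

/-! ## Part 6 (v1.1). Lemma E.1 (1)–(2) IN GRAPH FORM: pruning, the centre-replacement comparison, and the
Steiner ratio `ℓ ≤ 2ℓ̃` by generations -/

section SteinerGraph

variable {Y : Finset P} {E : Finset (Sym2 P)} {p : P}

/-- Reachability is monotone in the edge set. [folklore] -/
theorem rtg_mono {F G : Finset (Sym2 P)} (h : F ⊆ G) {x y : P} (hxy : Relation.ReflTransGen (EAdj F) x y) :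
    Relation.ReflTransGen (EAdj G) x y := by
  induction hxy with
  | refl => exact Relation.ReflTransGen.refl
  | tail _ hbc ih => exact ih.tail (h hbc)

/-- An edge set inside `Y.sym2`, loop-free, in which every vertex of `Y` reaches a fixed vertex `q`, connects `Y`.
[folklore] -/
theorem isConnOn_of_reaches {F : Finset (Sym2 P)} (q : P) (hsub : F ⊆ Y.sym2) (hloop : ∀ e ∈ F, ¬e.IsDiag)
    (hreach : ∀ y ∈ Y, Relation.ReflTransGen (EAdj F) y q) : IsConnOn Y F :=
  ⟨hsub, hloop, fun x hx y hy => (hreach x hx).trans (reflTransGen_eAdj_symm (hreach y hy))⟩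

/-- The stronger form of the generation step: `Σ_K (φ s(p,r_K) + wt(E|_K)) ≤ wt E` (root edges distinct, branch
edge sets pairwise disjoint, all inside `E`; `φ ≥ 0` off the diagonal). [folklore] -/
theorem sum_root_add_wt_restr_le {φ : Sym2 P → ℝ} (hφ : ∀ e, ¬e.IsDiag → 0 ≤ φ e) (hE : IsConnOn Y E)
    (hp : p ∈ Y) : ∑ K ∈ branches Y E p, (φ s(p, root E p K) + wt φ (restr E p K)) ≤ wt φ E := by
  have hφE : ∀ e ∈ E, 0 ≤ φ e := fun e he => hφ e (hE.2.1 e he)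
  rw [Finset.sum_add_distrib]
  have hsplit : wt φ E = ∑ e ∈ E.filter (fun e => p ∈ e), φ e + ∑ e ∈ E.filter (fun e => p ∉ e), φ e := by
    unfold wt; rw [Finset.sum_filter_add_sum_filter_not]
  rw [hsplit]
  refine add_le_add ?_ ?_
  · rw [← Finset.sum_image (f := φ) (rootEdge_injOn hE hp)]
    refine Finset.sum_le_sum_of_subset_of_nonneg (fun e he => ?_) fun e he _ => hφE e (mem_filter.1 he).1
    rw [mem_image] at he
    obtain ⟨K, hK, rfl⟩ := he
    exact mem_filter.2 ⟨(root_spec hE hp hK).2, Sym2.mem_mk_left _ _⟩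
  · calc ∑ K ∈ branches Y E p, wt φ (restr E p K) = ∑ e ∈ (branches Y E p).biUnion (restr E p), φ e := by
          unfold wt
          rw [Finset.sum_biUnion]
          intro K hK K' hK' hne
          exact disjoint_restr_of_ne (Finset.mem_coe.1 hK) (Finset.mem_coe.1 hK') hne
      _ ≤ ∑ e ∈ E.filter (fun e => p ∉ e), φ e := by
          refine Finset.sum_le_sum_of_subset_of_nonneg (fun e he => ?_) fun e he _ => hφE e (mem_filter.1 he).1
          rw [mem_biUnion] at he
          obtain ⟨K, _, he⟩ := he
          exact restr_subset K he

/-- A branch is non-empty (it contains its root). [folklore] -/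
theorem branch_nonempty (hE : IsConnOn Y E) (hp : p ∈ Y) {K : Finset P} (hK : K ∈ branches Y E p) : K.Nonempty :=
  ⟨root E p K, (root_spec hE hp hK).1⟩

/-- A branch is a proper subset of `Y`. [folklore] -/
theorem branch_ssubset (hp : p ∈ Y) {K : Finset P} (hK : K ∈ branches Y E p) : K ⊂ Y :=
  Finset.ssubset_of_subset_of_ssubset (branch_subset hK) (Finset.erase_ssubset hp)

/-- **PRUNING** — every connecting edge set of a non-empty `Y` contains a connecting subset with at most `#Y − 1`
edges (hence exactly `#Y − 1`, `card_sub_one_le_card_of_isConnOn`): by generations, keep one root edge per branch and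
prune each branch recursively.  (This is the only place where "a minimal connecting set is a tree" is used, in the
weak form of an edge count.) [folklore] -/
theorem exists_conn_subset_card_le (Y : Finset P) :
    ∀ E : Finset (Sym2 P), IsConnOn Y E → Y.Nonempty → ∃ F ⊆ E, IsConnOn Y F ∧ F.card + 1 ≤ Y.card := by
  induction Y using Finset.strongInduction with
  | H Y ih =>
    intro E hE hY
    obtain ⟨p, hp⟩ := hY
    have hbr : ∀ K ∈ branches Y E p, ∃ F ⊆ restr E p K, IsConnOn K F ∧ F.card + 1 ≤ K.card := fun K hK =>
      ih K (branch_ssubset hp hK) (restr E p K) (restr_isConnOn hE hK) (branch_nonempty hE hp hK)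
    choose! FK hFKsub hFKconn hFKcard using hbr
    set B := branches Y E p with hB
    have hFE : ∀ K ∈ B, ∀ e ∈ FK K, e ∈ E := fun K hK e he => (mem_filter.1 (hFKsub K hK he)).1
    refine ⟨B.biUnion FK ∪ B.image (fun K => s(p, root E p K)), ?_, ?_, ?_⟩
    · intro e he
      rw [Finset.mem_union] at he
      rcases he with he | he
      · rw [mem_biUnion] at he
        obtain ⟨K, hK, he⟩ := he
        exact hFE K hK e he
      · rw [mem_image] at he
        obtain ⟨K, hK, rfl⟩ := he
        exact (root_spec hE hp hK).2
    · refine isConnOn_of_reaches p (fun e he => ?_) (fun e he => ?_) (fun y hy => ?_)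
      · rw [Finset.mem_union] at he
        rcases he with he | he
        · rw [mem_biUnion] at he
          obtain ⟨K, hK, he⟩ := he
          exact hE.1 (hFE K hK e he)
        · rw [mem_image] at he
          obtain ⟨K, hK, rfl⟩ := he
          exact hE.1 (root_spec hE hp hK).2
      · rw [Finset.mem_union] at he
        rcases he with he | he
        · rw [mem_biUnion] at he
          obtain ⟨K, hK, he⟩ := he
          exact hE.2.1 e (hFE K hK e he)
        · rw [mem_image] at he
          obtain ⟨K, hK, rfl⟩ := he
          exact hE.2.1 _ (root_spec hE hp hK).2
      · by_cases hyp : y = p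
        · subst hyp; exact Relation.ReflTransGen.refl
        · have hy' : y ∈ Y.erase p := Finset.mem_erase.2 ⟨hyp, hy⟩
          have hK : comp Y E p y ∈ B := by rw [hB]; exact Finset.mem_image_of_mem _ hy'
          have hr := root_spec hE hp hK
          have h1 : Relation.ReflTransGen (EAdj (FK (comp Y E p y))) y (root E p (comp Y E p y)) :=
            (hFKconn _ hK).2.2 y (self_mem_comp hy') _ hr.1
          refine (rtg_mono (F := FK (comp Y E p y)) ?_ h1).tail ?_
          · exact (Finset.subset_biUnion_of_mem FK hK).trans Finset.subset_union_left
          · unfold EAdj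
            rw [Sym2.eq_swap]
            exact Finset.mem_union_right _ (Finset.mem_image_of_mem _ hK)
    · have hcard : (B.biUnion FK ∪ B.image (fun K => s(p, root E p K))).card ≤ ∑ K ∈ B, (FK K).card + B.card :=
        (Finset.card_union_le _ _).trans (add_le_add Finset.card_biUnion_le Finset.card_image_le)
      have hsum : ∑ K ∈ B, (FK K).card + B.card ≤ ∑ K ∈ B, K.card := by
        rw [Finset.card_eq_sum_ones B, ← Finset.sum_add_distrib]
        exact Finset.sum_le_sum fun K hK => hFKcard K hK
      have hYc : ∑ K ∈ B, K.card = (Y.erase p).card := by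
        rw [← biUnion_branches (E := E), Finset.card_biUnion pairwiseDisjoint_branches]; rfl
      rw [Finset.card_erase_of_mem hp] at hYc
      have := Finset.card_pos.2 ⟨p, hp⟩
      omega

/-- **LEMMA E.1 (2) IN GRAPH FORM — the centre replacement** — [Dimock2013BalabanII] App. E, verbatim: *"ℓ′_M(Y) ≤
ℓ_M(Y) + |Y|_M"*, proof L6808–6815: *"Let τ be a minimal tree on the blocks of Y of length ℓ(τ) = ℓ(Y). Replace each
line by a line from center to center and call the resulting tree τ′. This increases the lengths by at most one. (We
use the metric |x−y| = sup_μ|x_μ − y_μ|). Then we have ℓ′(Y) ≤ ℓ(τ′) ≤ ℓ(τ) + |Y| = ℓ(Y) + |Y|"* — PROVED abstractly: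
if two weights on the pairs of `Y` satisfy `φ₂ ≤ φ₁ + c` off the diagonal (`φ₁ ≥ 0`, `c ≥ 0`; in print `φ₁` = the
distance of the chosen points, `φ₂` = the distance of the centres, `c = 1`), then `ℓ′_{φ₂}(Y) ≤ ℓ′_{φ₁}(Y) + c(#Y − 1)`
(a minimal `φ₁`-set pruned to `#Y − 1` edges; the print's `+|Y|` a fortiori).
[cite: Dimock2013BalabanII, App. E Lemma E.1 (2) (arXiv:1212.5562v2 TeX L6794–6795, proof L6808–6815)] -/
theorem treeLen'_le_treeLen'_add {φ₁ φ₂ : Sym2 P → ℝ} {c : ℝ} (hc : 0 ≤ c) (hφ₁ : ∀ e, ¬e.IsDiag → 0 ≤ φ₁ e)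
    (hle : ∀ e, ¬e.IsDiag → φ₂ e ≤ φ₁ e + c) {Y : Finset P} (hY : Y.Nonempty) :
    treeLen' φ₂ Y ≤ treeLen' φ₁ Y + c * ((Y.card : ℝ) - 1) := by
  obtain ⟨F, hFsub, hF, hFcard⟩ := exists_conn_subset_card_le Y (minConn φ₁ Y) (minConn_isConnOn φ₁ Y) hY
  have h1 : treeLen' φ₂ Y ≤ wt φ₂ F := treeLen'_le_wt hF
  have h2 : wt φ₂ F ≤ wt φ₁ F + c * F.card := by
    unfold wt
    calc ∑ e ∈ F, φ₂ e ≤ ∑ e ∈ F, (φ₁ e + c) := Finset.sum_le_sum fun e he => hle e (hF.2.1 e he)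
      _ = ∑ e ∈ F, φ₁ e + c * F.card := by rw [Finset.sum_add_distrib, Finset.sum_const, nsmul_eq_mul, mul_comm]
  have h3 : wt φ₁ F ≤ wt φ₁ (minConn φ₁ Y) :=
    Finset.sum_le_sum_of_subset_of_nonneg hFsub fun e he _ => hφ₁ e ((minConn_isConnOn φ₁ Y).2.1 e he)
  rw [wt_minConn] at h3
  have h4 : (F.card : ℝ) ≤ (Y.card : ℝ) - 1 := by
    have : (F.card : ℝ) + 1 ≤ Y.card := by exact_mod_cast hFcard
    linarith
  nlinarith

/-- Sums of non-negative terms over a union are at most the sum of the two sums. [folklore] -/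
theorem sum_union_le_of_nonneg {α : Type*} [DecidableEq α] (A B : Finset α) (a : α → ℝ) (ha : ∀ x, 0 ≤ a x) :
    ∑ x ∈ A ∪ B, a x ≤ ∑ x ∈ A, a x + ∑ x ∈ B, a x := by
  rw [← Finset.sum_union_inter]
  linarith [Finset.sum_nonneg (s := A ∩ B) fun x _ => ha x]

/-- Sums of non-negative terms over a union of a family are at most the sum of the sums. [folklore] -/
theorem sum_biUnion_le_of_nonneg {α ι : Type*} [DecidableEq α] [DecidableEq ι] (I : Finset ι) (Q : ι → Finset α)
    (a : α → ℝ) (ha : ∀ x, 0 ≤ a x) : ∑ x ∈ I.biUnion Q, a x ≤ ∑ c ∈ I, ∑ x ∈ Q c, a x := by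
  induction I using Finset.induction_on with
  | empty => simp
  | @insert c I hc ih =>
    rw [Finset.biUnion_insert, Finset.sum_insert hc]
    exact (sum_union_le_of_nonneg _ _ a ha).trans (by linarith)

/-- Sums of non-negative terms over an image are at most the sum over the source. [folklore] -/
theorem sum_image_le_sum_of_nonneg {ι α : Type*} [DecidableEq α] (s : Finset ι) (g : ι → α) (f : α → ℝ)
    (hf : ∀ a, 0 ≤ f a) : ∑ a ∈ s.image g, f a ≤ ∑ i ∈ s, f (g i) := by
  rw [← Finset.sum_fiberwise_of_maps_to (s := s) (t := s.image g) (g := g)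
    (fun i hi => Finset.mem_image_of_mem g hi) (fun i => f (g i))]
  refine Finset.sum_le_sum fun a ha => ?_
  obtain ⟨i, hi, rfl⟩ := Finset.mem_image.1 ha
  have hmem : i ∈ s.filter (fun j => g j = g i) := Finset.mem_filter.2 ⟨hi, rfl⟩
  calc f (g i) ≤ ∑ j ∈ s.filter (fun j => g j = g i), f (g i) :=
        Finset.single_le_sum (f := fun _ => f (g i)) (fun _ _ => hf _) hmem
    _ = ∑ j ∈ s.filter (fun j => g j = g i), f (g j) :=
        Finset.sum_congr rfl fun j hj => by rw [(Finset.mem_filter.1 hj).2]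

/-- A symmetric function as a weight on `Sym2`. [folklore] -/
def symW (d : P → P → ℝ) (hds : ∀ x y, d x y = d y x) : Sym2 P → ℝ := Sym2.lift ⟨d, hds⟩

/-- `symW d s(x,y) = d x y`. [folklore] -/
@[simp] theorem symW_mk (d : P → P → ℝ) (hds : ∀ x y, d x y = d y x) (x y : P) : symW d hds s(x, y) = d x y := rfl

/-- Edges of a connecting set of `R ∩ K` are edges on `R`. [folklore] -/
theorem sym2_of_inter {R K : Finset P} {e : Sym2 P} (h : e ∈ (R ∩ K).sym2) : e ∈ R.sym2 :=
  Finset.mem_sym2_iff.2 fun a ha => Finset.mem_of_mem_inter_left (Finset.mem_sym2_iff.1 h a ha)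

/-- THE STEINER POTENTIAL LEMMA (by generations): for a pseudo-metric `d` (symmetric, triangle inequality, `d ≥ 0`,
`d(x,x) = 0`), a finite `V` connected by `E`, a base point `x ∈ V` and a non-empty `R ⊆ V` there is a terminal
`t ∈ R` with `ℓ′_d(R) + 2d(x,t) ≤ 2·wt_d(E)`.  Step: remove `x`; on each branch `K` meeting `R` the hypothesis gives
`t_K`; if `x ∈ R` join `x` to every `t_K` (cost `≤ w_K + δ_K`), else join every `t_K` to the `t_{K₁}` minimising
`w_K + δ_K` (cost `≤ δ_K + w_K + w_{K₁} + δ_{K₁}`) and take `t = t_{K₁}`; the factor `2` absorbs the detours.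
[folklore] -/
theorem steiner_potential {d : P → P → ℝ} (hds : ∀ x y, d x y = d y x) (hd0 : ∀ x, d x x = 0)
    (hdn : ∀ x y, 0 ≤ d x y) (hdt : ∀ x y z, d x z ≤ d x y + d y z) (V : Finset P) :
    ∀ (E : Finset (Sym2 P)), IsConnOn V E → ∀ x ∈ V, ∀ R ⊆ V, R.Nonempty →
      ∃ t ∈ R, treeLen' (symW d hds) R + 2 * d x t ≤ 2 * wt (symW d hds) E := by
  have hφ' : ∀ e, 0 ≤ symW d hds e := fun e => by
    induction e using Sym2.ind with
    | h a b => rw [symW_mk]; exact hdn a b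
  have hφ : ∀ e, ¬e.IsDiag → 0 ≤ symW d hds e := fun e _ => hφ' e
  induction V using Finset.strongInduction with
  | H V ih =>
    intro E hE x hx R hRV hR
    haveI : Nonempty P := ⟨x⟩
    set φ := symW d hds with hφdef
    set B := branches V E x with hB
    set L := B.filter (fun K => (R ∩ K).Nonempty) with hL
    have hLB : ∀ K ∈ L, K ∈ B := fun K hK => (mem_filter.1 hK).1
    have hIH : ∀ K ∈ L, ∃ t ∈ R ∩ K, treeLen' φ (R ∩ K) + 2 * d (root E x K) t ≤ 2 * wt φ (restr E x K) := by
      intro K hK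
      have hKB := hLB K hK
      exact ih K (branch_ssubset hx hKB) (restr E x K) (restr_isConnOn hE hKB) (root E x K)
        (root_spec hE hx hKB).1 (R ∩ K) Finset.inter_subset_right (mem_filter.1 hK).2
    choose! tK htKmem htKle using hIH
    have htK : ∀ K ∈ L, tK K ∈ R ∧ tK K ∈ K := fun K hK => Finset.mem_inter.1 (htKmem K hK)
    -- abbreviations: the root edge weight and the detour to the chosen terminal
    set w : Finset P → ℝ := fun K => φ s(x, root E x K) with hw
    set δ : Finset P → ℝ := fun K => d (root E x K) (tK K) with hδ
    have hwd : ∀ K, w K = d x (root E x K) := fun K => rfl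
    have hw0 : ∀ K, 0 ≤ w K := fun K => hφ' _
    have hδ0 : ∀ K, 0 ≤ δ K := fun K => hdn _ _
    have hgen : ∑ K ∈ B, (w K + wt φ (restr E x K)) ≤ wt φ E := sum_root_add_wt_restr_le hφ hE hx
    have hgenL : ∑ K ∈ L, (w K + wt φ (restr E x K)) ≤ wt φ E :=
      (Finset.sum_le_sum_of_subset_of_nonneg (Finset.filter_subset _ _) fun K _ _ =>
        add_nonneg (hw0 K) (Finset.sum_nonneg fun e _ => hφ' e)).trans hgen
    -- every terminal other than `x` lies in a live branch
    have hcover : ∀ r ∈ R, r ≠ x → ∃ K ∈ L, r ∈ K := by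
      intro r hr hrx
      have hr' : r ∈ V.erase x := Finset.mem_erase.2 ⟨hrx, hRV hr⟩
      refine ⟨comp V E x r, mem_filter.2 ⟨?_, ⟨r, Finset.mem_inter.2 ⟨hr, self_mem_comp hr'⟩⟩⟩, self_mem_comp hr'⟩
      rw [hB]; exact Finset.mem_image_of_mem _ hr'
    -- the per-branch pieces: minimal connecting sets of `R ∩ K`
    set M : Finset P → Finset (Sym2 P) := fun K => minConn φ (R ∩ K) with hM
    have hMconn : ∀ K, IsConnOn (R ∩ K) (M K) := fun K => minConn_isConnOn φ (R ∩ K)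
    have hMwt : ∀ K, wt φ (M K) = treeLen' φ (R ∩ K) := fun K => wt_minConn φ (R ∩ K)
    have hLdisj : ∀ K ∈ L, ∀ K' ∈ L, ∀ z, z ∈ K → z ∈ K' → K = K' := by
      intro K hK K' hK' z hz hz'
      by_contra hne
      exact Finset.disjoint_left.1 (pairwiseDisjoint_branches (hLB K hK) (hLB K' hK') hne) hz hz'
    have hpieces : ∑ e ∈ L.biUnion M, φ e ≤ ∑ K ∈ L, treeLen' φ (R ∩ K) :=
      (sum_biUnion_le_of_nonneg L M φ hφ').trans (le_of_eq (Finset.sum_congr rfl fun K _ => hMwt K))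
    -- a vertex of `R` in a live branch reaches that branch's terminal inside the pieces
    have hreachK : ∀ (G : Finset (Sym2 P)), L.biUnion M ⊆ G → ∀ y ∈ R, ∀ K ∈ L, y ∈ K →
        Relation.ReflTransGen (EAdj G) y (tK K) := by
      intro G hG y hy K hK hyK
      exact rtg_mono ((Finset.subset_biUnion_of_mem M hK).trans hG)
        ((hMconn K).2.2 y (Finset.mem_inter.2 ⟨hy, hyK⟩) (tK K) (htKmem K hK))
    by_cases hxR : x ∈ R
    · ------------------------------------------------------------- case `x ∈ R`: witness `t = x`
      refine ⟨x, hxR, ?_⟩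
      rw [hd0, mul_zero, add_zero]
      set G := L.biUnion M ∪ L.image (fun K => s(x, tK K)) with hG
      have hGconn : IsConnOn R G := by
        refine isConnOn_of_reaches x (fun e he => ?_) (fun e he => ?_) (fun y hy => ?_)
        · rw [Finset.mem_union] at he
          rcases he with he | he
          · rw [mem_biUnion] at he
            obtain ⟨K, _, he⟩ := he
            exact sym2_of_inter ((hMconn K).1 he)
          · rw [mem_image] at he
            obtain ⟨K, hK, rfl⟩ := he
            exact Finset.mk_mem_sym2_iff.2 ⟨hxR, (htK K hK).1⟩
        · rw [Finset.mem_union] at he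
          rcases he with he | he
          · rw [mem_biUnion] at he
            obtain ⟨K, _, he⟩ := he
            exact (hMconn K).2.1 e he
          · rw [mem_image] at he
            obtain ⟨K, hK, rfl⟩ := he
            rw [Sym2.mk_isDiag_iff]
            intro hxt
            exact (Finset.mem_erase.1 (branch_subset (hLB K hK) (htK K hK).2)).1 hxt.symm
        · by_cases hyx : y = x
          · subst hyx; exact Relation.ReflTransGen.refl
          · obtain ⟨K, hK, hyK⟩ := hcover y hy hyx
            refine (hreachK G Finset.subset_union_left y hy K hK hyK).tail ?_
            unfold EAdj; rw [Sym2.eq_swap]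
            exact Finset.mem_union_right _ (Finset.mem_image_of_mem _ hK)
      have hGwt : wt φ G ≤ ∑ K ∈ L, treeLen' φ (R ∩ K) + ∑ K ∈ L, (w K + δ K) := by
        unfold wt
        refine (sum_union_le_of_nonneg _ _ φ hφ').trans (add_le_add hpieces ?_)
        refine (sum_image_le_sum_of_nonneg L (fun K => s(x, tK K)) φ hφ').trans ?_
        refine Finset.sum_le_sum fun K _ => ?_
        rw [hφdef, symW_mk, hwd]
        exact hdt x (root E x K) (tK K)
      calc treeLen' φ R ≤ wt φ G := treeLen'_le_wt hGconn
        _ ≤ ∑ K ∈ L, treeLen' φ (R ∩ K) + ∑ K ∈ L, (w K + δ K) := hGwt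
        _ ≤ ∑ K ∈ L, (2 * wt φ (restr E x K) - 2 * δ K) + ∑ K ∈ L, (w K + δ K) :=
            add_le_add (Finset.sum_le_sum fun K hK => by linarith [htKle K hK]) le_rfl
        _ = ∑ K ∈ L, (2 * wt φ (restr E x K) + w K - δ K) := by
            rw [← Finset.sum_add_distrib]; exact Finset.sum_congr rfl fun K _ => by ring
        _ ≤ ∑ K ∈ L, (2 * (w K + wt φ (restr E x K))) :=
            Finset.sum_le_sum fun K _ => by linarith [hw0 K, hδ0 K]
        _ = 2 * ∑ K ∈ L, (w K + wt φ (restr E x K)) := by rw [Finset.mul_sum]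
        _ ≤ 2 * wt φ E := by linarith
    · ------------------------------------------------------------- case `x ∉ R`: witness `t = t_{K₁}`
      have hLne : L.Nonempty := by
        obtain ⟨r, hr⟩ := hR
        obtain ⟨K, hK, _⟩ := hcover r hr (fun h => hxR (h ▸ hr))
        exact ⟨K, hK⟩
      obtain ⟨K₁, hK₁, hmin⟩ := Finset.exists_min_image L (fun K => w K + δ K) hLne
      refine ⟨tK K₁, (htK K₁ hK₁).1, ?_⟩
      set G := L.biUnion M ∪ (L.erase K₁).image (fun K => s(tK K, tK K₁)) with hG
      have hGconn : IsConnOn R G := by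
        refine isConnOn_of_reaches (tK K₁) (fun e he => ?_) (fun e he => ?_) (fun y hy => ?_)
        · rw [Finset.mem_union] at he
          rcases he with he | he
          · rw [mem_biUnion] at he
            obtain ⟨K, _, he⟩ := he
            exact sym2_of_inter ((hMconn K).1 he)
          · rw [mem_image] at he
            obtain ⟨K, hK, rfl⟩ := he
            exact Finset.mk_mem_sym2_iff.2 ⟨(htK K (Finset.mem_of_mem_erase hK)).1, (htK K₁ hK₁).1⟩
        · rw [Finset.mem_union] at he
          rcases he with he | he
          · rw [mem_biUnion] at he
            obtain ⟨K, _, he⟩ := he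
            exact (hMconn K).2.1 e he
          · rw [mem_image] at he
            obtain ⟨K, hK, rfl⟩ := he
            rw [Sym2.mk_isDiag_iff]
            intro ht
            have hKL := Finset.mem_of_mem_erase hK
            exact (Finset.mem_erase.1 hK).1 (hLdisj K hKL K₁ hK₁ (tK K) (htK K hKL).2 (ht ▸ (htK K₁ hK₁).2))
        · have hyx : y ≠ x := fun h => hxR (h ▸ hy)
          obtain ⟨K, hK, hyK⟩ := hcover y hy hyx
          have h2 := hreachK G Finset.subset_union_left y hy K hK hyK
          by_cases hKK : K = K₁
          · subst hKK; exact h2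
          · refine h2.tail ?_
            unfold EAdj
            exact Finset.mem_union_right _ (Finset.mem_image_of_mem _ (Finset.mem_erase.2 ⟨hKK, hK⟩))
      have hGwt : wt φ G ≤ ∑ K ∈ L, treeLen' φ (R ∩ K) + ∑ K ∈ L.erase K₁, (δ K + w K + (w K₁ + δ K₁)) := by
        unfold wt
        refine (sum_union_le_of_nonneg _ _ φ hφ').trans (add_le_add hpieces ?_)
        refine (sum_image_le_sum_of_nonneg (L.erase K₁) (fun K => s(tK K, tK K₁)) φ hφ').trans ?_
        refine Finset.sum_le_sum fun K _ => ?_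
        rw [hφdef, symW_mk]
        calc d (tK K) (tK K₁) ≤ d (tK K) x + d x (tK K₁) := hdt _ _ _
          _ ≤ (d (tK K) (root E x K) + d (root E x K) x) + (d x (root E x K₁) + d (root E x K₁) (tK K₁)) :=
              add_le_add (hdt _ _ _) (hdt _ _ _)
          _ = δ K + w K + (w K₁ + δ K₁) := by rw [hwd, hwd, hds (tK K), hds (root E x K) x]
      have hmin' : ∑ K ∈ L.erase K₁, (w K₁ + δ K₁) ≤ ∑ K ∈ L.erase K₁, (w K + δ K) :=
        Finset.sum_le_sum fun K hK => hmin K (Finset.mem_of_mem_erase hK)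
      have hsplit : ∀ f : Finset P → ℝ, ∑ K ∈ L, f K = f K₁ + ∑ K ∈ L.erase K₁, f K := fun f =>
        (Finset.add_sum_erase L f hK₁).symm
      have hdx : d x (tK K₁) ≤ w K₁ + δ K₁ := by rw [hwd]; exact hdt _ _ _
      have hIH' : ∑ K ∈ L, treeLen' φ (R ∩ K) ≤ ∑ K ∈ L, (2 * wt φ (restr E x K) - 2 * δ K) :=
        Finset.sum_le_sum fun K hK => by linarith [htKle K hK]
      -- bookkeeping: Σ_{K≠K₁}(δ+w+(w₁+δ₁)) + 2(w₁+δ₁) ≤ Σ_{K∈L} 2(w+δ), and Σ_L (2wt − 2δ) + Σ_L 2(w+δ) = 2Σ_L(w+wt)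
      have hA : ∑ K ∈ L.erase K₁, (δ K + w K + (w K₁ + δ K₁)) + 2 * (w K₁ + δ K₁) ≤ ∑ K ∈ L, (2 * (w K + δ K)) := by
        rw [hsplit (fun K => 2 * (w K + δ K))]
        have e1 : ∑ K ∈ L.erase K₁, (δ K + w K + (w K₁ + δ K₁)) =
            ∑ K ∈ L.erase K₁, (w K + δ K) + ∑ K ∈ L.erase K₁, (w K₁ + δ K₁) := by
          rw [← Finset.sum_add_distrib]; exact Finset.sum_congr rfl fun K _ => by ring
        have e2 : ∑ K ∈ L.erase K₁, (2 * (w K + δ K)) = 2 * ∑ K ∈ L.erase K₁, (w K + δ K) := by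
          rw [Finset.mul_sum]
        rw [e1, e2]
        linarith
      have hB' : ∑ K ∈ L, (2 * wt φ (restr E x K) - 2 * δ K) + ∑ K ∈ L, (2 * (w K + δ K)) =
          2 * ∑ K ∈ L, (w K + wt φ (restr E x K)) := by
        rw [← Finset.sum_add_distrib, Finset.mul_sum]
        exact Finset.sum_congr rfl fun K _ => by ring
      calc treeLen' φ R + 2 * d x (tK K₁)
          ≤ wt φ G + 2 * (w K₁ + δ K₁) := add_le_add (treeLen'_le_wt hGconn) (by linarith)
        _ ≤ ∑ K ∈ L, (2 * wt φ (restr E x K) - 2 * δ K) +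
              (∑ K ∈ L.erase K₁, (δ K + w K + (w K₁ + δ K₁)) + 2 * (w K₁ + δ K₁)) := by linarith
        _ ≤ ∑ K ∈ L, (2 * wt φ (restr E x K) - 2 * δ K) + ∑ K ∈ L, (2 * (w K + δ K)) :=
              add_le_add le_rfl hA
        _ = 2 * ∑ K ∈ L, (w K + wt φ (restr E x K)) := hB'
        _ ≤ 2 * wt φ E := by linarith

/-- **LEMMA E.1 (1) IN GRAPH FORM — THE STEINER RATIO `ℓ ≤ 2ℓ̃`** — [Dimock2013BalabanII] App. E, verbatim: *"ℓ_M(Y) ≤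
2ℓ̃_M(Y)"*, proof L6804–6807 ([DIS73]): *"Let τ̃ be a minimal tree of length ℓ(τ̃) = ℓ̃(Y). One can traverse τ̃ with
a path γ̃ which passes through every vertex and has length 2ℓ̃_M(Y). … Replace the segment from the vertex v_i to the
vertex v_{i+1} by a straight line. This gives a path γ which passes thru each vertex exactly once and is shorter than
γ̃. Hence ℓ(Y) ≤ ℓ(γ) ≤ ℓ(γ̃) = 2ℓ̃(Y)"* — PROVED for finite graphs over any pseudo-metric `d` (symmetric, triangle
inequality, `d ≥ 0`, `d(x,x) = 0`): if `E` connects a finite `V ⊇ R ≠ ∅` (the Steiner points are `V ∖ R`), then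
`ℓ′_d(R) ≤ 2·Σ_{e∈E} d(e)` — by generations (`steiner_potential`) instead of the Euler tour.  The continuum statement
(polygonal Steiner trees subdivided at the visited blocks) is NOT formalised here.
[cite: Dimock2013BalabanII, App. E Lemma E.1 (1) (arXiv:1212.5562v2 TeX L6792–6793, proof L6804–6807)] -/
theorem treeLen'_le_two_mul_wt {d : P → P → ℝ} (hds : ∀ x y, d x y = d y x) (hd0 : ∀ x, d x x = 0)
    (hdn : ∀ x y, 0 ≤ d x y) (hdt : ∀ x y z, d x z ≤ d x y + d y z) {V R : Finset P} (hRV : R ⊆ V)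
    (hR : R.Nonempty) {E : Finset (Sym2 P)} (hE : IsConnOn V E) :
    treeLen' (symW d hds) R ≤ 2 * wt (symW d hds) E := by
  obtain ⟨r, hr⟩ := hR
  obtain ⟨t, _, ht⟩ := steiner_potential hds hd0 hdn hdt V E hE r (hRV hr) R hRV ⟨r, hr⟩
  linarith [hdn r t]

/-- **E.1 (1) + (2) COMBINED, GRAPH FORM: `ℓ′(Y) ≤ 2ℓ̃ + (#Y − 1)`** — for a pseudo-metric `d` on points, chosen
points `pt y` (one per block `y`; the blocks `W ⊇ Y` carry a connecting "Steiner" edge set `E`, weighted by the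
distance of the chosen points) and a centre weight `φ₂` on blocks with `φ₂ s(y,y′) ≤ d(pt y, pt y′) + c` for `y ≠ y′`
(`c = 1` for the sup metric and unit blocks): `ℓ′_{φ₂}(Y) ≤ 2·wt(E) + c(#Y − 1)`.
[cite: Dimock2013BalabanII, App. E Lemma E.1 (1)–(2) (arXiv:1212.5562v2 TeX L6792–6795)] -/
theorem treeLen'_le_two_mul_steiner_add {Q : Type*} {d : P → P → ℝ} (hds : ∀ x y, d x y = d y x)
    (hd0 : ∀ x, d x x = 0) (hdn : ∀ x y, 0 ≤ d x y) (hdt : ∀ x y z, d x z ≤ d x y + d y z) (pt : Q → P)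
    {φ₂ : Sym2 Q → ℝ} {c : ℝ} (hc : 0 ≤ c) (hle : ∀ y y' : Q, y ≠ y' → φ₂ s(y, y') ≤ d (pt y) (pt y') + c)
    {Y : Finset Q} (hY : Y.Nonempty) {W : Finset Q} (hYW : Y ⊆ W) {E : Finset (Sym2 Q)}
    (hE : IsConnOn W E) :
    treeLen' φ₂ Y ≤ 2 * wt (symW (fun y y' => d (pt y) (pt y')) (fun _ _ => hds _ _)) E +
      c * ((Y.card : ℝ) - 1) := by
  have hds' : ∀ y y' : Q, d (pt y) (pt y') = d (pt y') (pt y) := fun _ _ => hds _ _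
  have h1 : treeLen' (symW (fun y y' => d (pt y) (pt y')) hds') Y ≤
      2 * wt (symW (fun y y' => d (pt y) (pt y')) hds') E :=
    treeLen'_le_two_mul_wt hds' (fun y => hd0 _) (fun y y' => hdn _ _) (fun x y z => hdt _ _ _) hYW hY hE
  have h2 : treeLen' φ₂ Y ≤ treeLen' (symW (fun y y' => d (pt y) (pt y')) hds') Y + c * ((Y.card : ℝ) - 1) := by
    refine treeLen'_le_treeLen'_add hc (fun e _ => ?_) (fun e he => ?_) hY
    · induction e using Sym2.ind with
      | h a b => rw [symW_mk]; exact hdn _ _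
    · induction e using Sym2.ind with
      | h a b => rw [Sym2.mk_isDiag_iff] at he; rw [symW_mk]; exact hle a b he
  linarith

end SteinerGraph

end Literature.MathematicalPhysics.QuantumFieldTheory.Dimock2011to13.DisconnectedPolymerSums
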